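import Literature.NumberTheory.Sieve.IwaniecAlmostPrimesGauss
import Literature.NumberTheory.Sieve.FejerKernelCounting
import HarnessLib

/-!
# Iwaniec (1978), §4: the exponential sums over the roots `Ω² + 1 ≡ 0 (mod qm)` behind Lemma 4 — PROVED from Lemma 6

H. Iwaniec, *Almost-primes represented by quadratic polynomials*, Invent. Math. **47** (1978)
171–188, §4, proof of Lemma 4 (pp. 179–181): the equidistribution of the fractions `Ω/(qm)`
(`Ω² + 1 ≡ 0 (mod qm)`, `M < m < M₁`, `(m, q) = 1`, `m ≡ μ (mod d)`, `Ω ≡ ω (mod d)`) is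
reduced, by Lemma 5 (Gauss–Lagrange: `qm = r² + s²`, `Ω ≡ −r s̄`, i.e.
`Ω/(qm) ≡ r̄/s − r/(s(r² + s²)) (mod 1)`) to incomplete Kloosterman-type sums
`∑_r e(h r̄/s)` over `r` in an interval and a residue class, which Lemma 6 (Hooley, from Weil's
bound; the tree's named fact `lemma6_hooley`, PROVED from Weil's Kloosterman bound in
`IwaniecAlmostPrimesHooley.lean`) estimates by `s^{1/2+ε}(h, s)^{1/2}`.  Second file of the
inline proof of Proposition 1 (`Literature.NumberTheory.Sieve.Iwaniec1978.proposition1`);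
everything here is PROVED from the hypothesis `lemma6_hooley`, no named facts are introduced.

* `rootsNat D`, `lemma4Family q Q d μ ω A B` / `lemma4FamilyDvd q l d μ ω A B` — the roots as
  integers `0 ≤ Θ < D` and the finite families of pairs `(m, Θ)` of Lemma 4 (`A < m ≤ B`,
  `(m, Q) = 1` resp. `l ∣ m`, `m ≡ μ (d)`, `Θ` a root mod `mq` with `Θ ≡ ω (d)`);
* `sum_rootsNat_eq_sum_gaussPairs`, `gaussRoot_val_modEq_iff`, `fourierChar_gaussRoot_eq` —
  Lemma 5 as a change of variables in root sums, the condition `Θ ≡ ω (d) ⇔ r + ωs ≡ 0 (d)`,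
  and the phase `e(hΩ/D) = e(h r̄/s) e(−hr/(sD))`;
* `sum_lemma4FamilyDvd_fourierChar_eq` — the family sum in Gauss coordinates: a sum over
  `1 ≤ s ≤ √(Bq)` of sums over `|r| < s` subject to `gaussCond` (coprimality, the three
  congruences `lq ∣ r²+s²`, `r²+s² ≡ qμ (qd)`, `r + ωs ≡ 0 (d)`, and the annulus
  `qA < r² + s² ≤ qB`);
* `norm_sum_mul_indicator_mul_le` (Abel summation against a weight of bounded variation: two
  monotone indicators and the slowly varying twist, `|Δ twist| ≤ 4π|h|/s³`),
  `norm_sum_Ioo_class_le` (one class modulo `Λ`, two halves of length `< 2s`, Lemma 6),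
  `norm_sum_Ioo_congr_le` (the congruences depend on `r mod Λ`, `Λ = lqd`; at most `d ρ(lq)`
  admissible classes, `card_filter_range_dvd_sq_add_sq`; empty unless `(s, lq) = 1`);
* `norm_sum_lemma4FamilyDvd_le`, `sum_sqrt_gcd_le` (`∑_{s≤S} √(h,s) ≤ τ(|h|) S`),
  `sum_lemma4Family_eq_sum_moebius` (Möbius in `l ∣ Q`), and the final
  **`norm_rootExpSum_le`**: assuming `lemma6_hooley`, for `ε > 0` there is `C` with
  `|∑_{(m,Θ) ∈ lemma4Family} e(hΘ/(mq))| ≤ C d (∑_{l∣Q} ρ(lq)) τ(|h|)(3 + 8π|h|/(Aq)) S^{1/2+ε} S`,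
  `S = ⌊√(Bq)⌋`, for `Q ≠ 0`, `q ≥ 1`, `d ∣ q`, `A ≥ 2`, `h ≠ 0` — i.e.
  `≪_ε d τ(Q)³ τ(h) (1 + |h|/(qA)) (qB)^{3/4+ε}`, Iwaniec's bound for the sum (11) on p. 180
  with the harmless extra factor `d` (on average over the dispersion variables `d = (n₁, n₂)`
  costs a logarithm).

The counting consequence (Lemma 4 proper, via the Fejér-kernel form of Erdős–Turán,
`FejerKernelCounting.lean`) is the next file.

## References

* H. Iwaniec, Invent. Math. 47 (1978) 171–188, §4, Lemmas 4–7 (`IwaniecInventiones1978`).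
* C. Hooley, Acta Math. 117 (1967) 281–299, Lemma 3 (Lemma 6 of the paper).
-/

noncomputable section

open Finset Real
open scoped FourierTransform

namespace Literature.NumberTheory.Sieve.Iwaniec1978

open Literature.NumberTheory.Sieve.FejerCounting (fourierChar_add_intCast)
open Literature.NumberTheory.Sieve.Vinogradov (norm_fourierChar)

/-! ### Roots as integer representatives, and the Gauss reparametrisation of a root sum -/

/-- The roots of `Θ² + 1 ≡ 0 (mod D)` as integers `0 ≤ Θ < D` (so `ρ(D) = #rootsNat D` by
definition of `rho`). [cite: IwaniecInventiones1978, Lemma 4] -/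
def rootsNat (D : ℕ) : Finset ℕ := (Finset.range D).filter (fun Θ => D ∣ Θ ^ 2 + 1)

/-- `ρ(D) = #rootsNat D`. [folklore] -/
theorem card_rootsNat (D : ℕ) : (rootsNat D).card = rho D := rfl

/-- Membership in `rootsNat`. [folklore] -/
theorem mem_rootsNat {D Θ : ℕ} : Θ ∈ rootsNat D ↔ Θ < D ∧ D ∣ Θ ^ 2 + 1 := by
  simp [rootsNat]

/-- **Root sums as sums over Gauss pairs** (Lemma 5 as a change of variables): for `D ≠ 2` and any
`G : ZMod D → ℂ`, `∑_{Θ root mod D} G(Θ) = ∑_{(r,s) ∈ gaussPairs D} G(Ω(r, s))`.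
[cite: IwaniecInventiones1978, Lemma 5] -/
theorem sum_rootsNat_eq_sum_gaussPairs {D : ℕ} [NeZero D] (hD2 : D ≠ 2) (G : ZMod D → ℂ) :
    ∑ Θ ∈ rootsNat D, G (Θ : ZMod D) = ∑ p ∈ gaussPairs D, G (gaussRoot D p) := by
  have h1 : ∑ Θ ∈ rootsNat D, G (Θ : ZMod D) = ∑ x ∈ negOneRoots D, G x := by
    refine Finset.sum_nbij (fun Θ : ℕ => (Θ : ZMod D)) ?_ ?_ ?_ (fun _ _ => rfl)
    · intro Θ hΘ
      rw [mem_rootsNat] at hΘ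
      rw [mem_negOneRoots]
      have : ((Θ ^ 2 + 1 : ℕ) : ZMod D) = 0 := (ZMod.natCast_eq_zero_iff _ _).mpr hΘ.2
      push_cast at this
      exact this
    · intro a ha b hb hab
      rw [Finset.mem_coe, mem_rootsNat] at ha hb
      have := (ZMod.natCast_eq_natCast_iff' a b D).mp hab
      rwa [Nat.mod_eq_of_lt ha.1, Nat.mod_eq_of_lt hb.1] at this
    · intro x hx
      rw [Finset.mem_coe, mem_negOneRoots] at hx
      refine ⟨x.val, ?_, ZMod.natCast_zmod_val x⟩
      rw [Finset.mem_coe, mem_rootsNat]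
      refine ⟨ZMod.val_lt x, ?_⟩
      rw [← ZMod.natCast_eq_zero_iff]
      push_cast
      rw [ZMod.natCast_zmod_val]
      exact hx
  have hb := lemma5_gauss (D := D) hD2
  rw [h1]
  symm
  exact Finset.sum_nbij (gaussRoot D) (fun p hp => hb.1 hp) hb.2.1 hb.2.2 (fun _ _ => rfl)

/-- **The congruence condition on the root in terms of the pair**: for `(r, s) ∈ gaussPairs D` and
`d ∣ D`, the root `Ω(r,s)` (as an integer `0 ≤ Ω < D`) satisfies `Ω ≡ ω (mod d)` iff
`r + ω s ≡ 0 (mod d)` (reduce `s Ω ≡ −r (mod D)` modulo `d`; `s` is invertible).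
[cite: IwaniecInventiones1978, §4 p. 180] -/
theorem gaussRoot_val_modEq_iff {D d : ℕ} [NeZero D] [NeZero d] (hdD : d ∣ D) {p : ℤ × ℤ}
    (hp : p ∈ gaussPairs D) (ω : ℕ) :
    (gaussRoot D p).val ≡ ω [MOD d] ↔ (p.1 : ZMod d) + (ω : ZMod d) * (p.2 : ZMod d) = 0 := by
  set x := gaussRoot D p with hx
  have hmul := snd_mul_gaussRoot hp
  -- push `s x = -r` through `ZMod D → ZMod d`
  let φ := ZMod.castHom hdD (ZMod d)
  have hφ : (p.2 : ZMod d) * (x.val : ZMod d) = -(p.1 : ZMod d) := by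
    have h := congrArg φ hmul
    rw [map_mul, map_neg, map_intCast, map_intCast, ZMod.castHom_apply, ZMod.cast_eq_val] at h
    exact h
  have hunit : IsUnit (p.2 : ZMod d) := by
    have hu := (isUnit_snd_of_mem hp).map φ
    rwa [map_intCast] at hu
  rw [← ZMod.natCast_eq_natCast_iff]
  constructor
  · intro h
    rw [h] at hφ
    linear_combination hφ
  · intro h
    have h' : (p.2 : ZMod d) * (ω : ZMod d) = (p.2 : ZMod d) * (x.val : ZMod d) := by
      rw [hφ]; linear_combination h
    exact (hunit.mul_right_inj.mp h').symm

/-- The Kloosterman-type phase of Lemma 6: `e(h r̄/s)` with `r̄ = ((r mod s)⁻¹)` taken in `[0, s)`.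
[cite: IwaniecInventiones1978, Lemma 6] -/
def hooleyPhase (h : ℤ) (s : ℕ) (r : ℤ) : ℂ :=
  Complex.exp (2 * Real.pi * Complex.I * ((h : ℂ) * ((((r : ZMod s)⁻¹).val : ℕ) : ℂ) / (s : ℂ)))

/-- `|e(h r̄/s)| = 1`. [folklore] -/
theorem norm_hooleyPhase (h : ℤ) (s : ℕ) (r : ℤ) : ‖hooleyPhase h s r‖ = 1 := by
  unfold hooleyPhase
  rw [Complex.norm_exp]
  simp only [Complex.mul_re, Complex.re_ofNat, Complex.ofReal_re, Complex.im_ofNat,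
    Complex.ofReal_im, mul_zero, sub_zero, Complex.I_re, Complex.mul_im, zero_mul, add_zero,
    Complex.I_im, mul_one, zero_sub]
  have : ((h : ℂ) * ((((r : ZMod s)⁻¹).val : ℕ) : ℂ) / (s : ℂ)).im = 0 := by
    rw [show (h : ℂ) * ((((r : ZMod s)⁻¹).val : ℕ) : ℂ) / (s : ℂ) =
      (((h : ℝ) * (((r : ZMod s)⁻¹).val : ℕ) / (s : ℝ) : ℝ) : ℂ) by push_cast; ring]
    exact Complex.ofReal_im _
  rw [this]
  simp

/-- `e(t)` as `exp(2πi t)`. [folklore] -/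
theorem fourierChar_eq_exp (t : ℝ) : (𝐞 t : ℂ) = Complex.exp (2 * Real.pi * Complex.I * t) := by
  rw [Real.fourierChar_apply]
  push_cast
  ring_nf

/-- **The phase in terms of the pair**: for `(r, s) ∈ gaussPairs D` and an integer `h`,
`e(h Ω(r,s)/D) = e(h r̄/s) · e(−h r/(s D))` — Lemma 5's formula `Ω = (r̄ D − r)/s` read modulo
`1` after division by `D`. [cite: IwaniecInventiones1978, §4 p. 180] -/
theorem fourierChar_gaussRoot_eq {D : ℕ} [NeZero D] {p : ℤ × ℤ} (hp : p ∈ gaussPairs D) (h : ℤ) :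
    (𝐞 ((h : ℝ) * ((gaussRoot D p).val : ℝ) / D) : ℂ) =
      hooleyPhase h p.2.toNat p.1 * 𝐞 (-((h : ℝ) * p.1 / (p.2 * D))) := by
  obtain ⟨hDeq, hg, hrs⟩ := mem_gaussPairs.mp hp
  have hs : 0 < p.2 := snd_pos_of_mem hp
  set sN := p.2.toNat with hsN
  have hsNeq : (sN : ℤ) = p.2 := Int.toNat_of_nonneg hs.le
  have hsN0 : 0 < sN := by omega
  haveI : NeZero sN := ⟨hsN0.ne'⟩
  -- the chosen inverse of `r` modulo `s`
  set rb : ℤ := (((p.1 : ZMod sN)⁻¹).val : ℤ) with hrb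
  have hunit : IsUnit (p.1 : ZMod sN) := by
    rw [ZMod.coe_int_isUnit_iff_isCoprime, hsNeq]
    exact Int.isCoprime_iff_gcd_eq_one.mpr (by rw [Int.gcd_comm]; exact hg)
  have hrbar : p.1 * rb ≡ 1 [ZMOD p.2] := by
    rw [← hsNeq, ← ZMod.intCast_eq_intCast_iff]
    push_cast
    rw [hrb]
    push_cast
    rw [ZMod.natCast_zmod_val]
    exact ZMod.mul_inv_of_unit _ hunit
  obtain ⟨hdvd, hform⟩ := gaussRoot_eq_formula hp hrbar
  set z : ℤ := (rb * D - p.1) / p.2 with hz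
  -- `Ω.val ≡ z (mod D)`
  have hΩz : (D : ℤ) ∣ z - ((gaussRoot D p).val : ℤ) := by
    rw [← ZMod.intCast_eq_intCast_iff_dvd_sub]
    push_cast
    rw [ZMod.natCast_zmod_val, hform]
  obtain ⟨k, hk⟩ := hΩz
  have hD0 : (D : ℝ) ≠ 0 := by exact_mod_cast (NeZero.ne D)
  have hs0 : (p.2 : ℝ) ≠ 0 := by exact_mod_cast hs.ne'
  -- replace `Ω.val` by `z` using the integer period of `e`
  have hval : ((gaussRoot D p).val : ℝ) = (z : ℝ) - D * k := by
    have : ((z - ((gaussRoot D p).val : ℤ) : ℤ) : ℝ) = ((D * k : ℤ) : ℝ) := by rw [hk]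
    push_cast at this
    linarith
  have hzR : (z : ℝ) = ((rb : ℝ) * D - p.1) / p.2 := by
    rw [hz, Int.cast_div hdvd (by exact_mod_cast hs.ne')]
    push_cast
    ring
  have harg : (h : ℝ) * ((gaussRoot D p).val : ℝ) / D =
      ((h : ℝ) * rb / p.2 + -((h : ℝ) * p.1 / (p.2 * D))) + ((-(h * k) : ℤ) : ℝ) := by
    rw [hval, hzR]
    push_cast
    field_simp
    ring
  rw [harg, fourierChar_add_intCast, AddChar.map_add_eq_mul, Circle.coe_mul]
  congr 1
  -- the first factor is the Hooley phase
  rw [fourierChar_eq_exp, hooleyPhase]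
  congr 1
  push_cast
  rw [hrb]
  push_cast
  rw [← hsNeq]
  push_cast
  ring

/-! ### Analytic tools: partial summation against a weight of bounded variation -/

/-- **Abel's inequality with a weight of bounded variation** (discrete, complex): if all partial
sums `∑_{i<k} a_i`, `k ≤ n`, have norm `≤ M`, then
`‖∑_{i<n} a_i w_i‖ ≤ M (‖w_{n−1}‖ + ∑_{i<n−1} ‖w_{i+1} − w_i‖)`. [folklore] -/
theorem norm_sum_mul_le_of_partialSums {n : ℕ} {a w : ℕ → ℂ} {M : ℝ}
    (ha : ∀ k, k ≤ n → ‖∑ i ∈ Finset.range k, a i‖ ≤ M) :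
    ‖∑ i ∈ Finset.range n, a i * w i‖ ≤
      M * (‖w (n - 1)‖ + ∑ i ∈ Finset.range (n - 1), ‖w (i + 1) - w i‖) := by
  have hparts := Finset.sum_range_by_parts w a n
  simp only [smul_eq_mul] at hparts
  have hcomm : ∑ i ∈ Finset.range n, a i * w i = ∑ i ∈ Finset.range n, w i * a i :=
    Finset.sum_congr rfl fun i _ => mul_comm _ _
  rw [hcomm, hparts]
  calc ‖w (n - 1) * ∑ i ∈ Finset.range n, a i -
        ∑ i ∈ Finset.range (n - 1), (w (i + 1) - w i) * ∑ j ∈ Finset.range (i + 1), a j‖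
      ≤ ‖w (n - 1) * ∑ i ∈ Finset.range n, a i‖ +
        ‖∑ i ∈ Finset.range (n - 1), (w (i + 1) - w i) * ∑ j ∈ Finset.range (i + 1), a j‖ :=
        norm_sub_le _ _
    _ ≤ ‖w (n - 1)‖ * M + ∑ i ∈ Finset.range (n - 1), ‖w (i + 1) - w i‖ * M := by
        refine add_le_add ?_ ?_
        · rw [norm_mul]; exact mul_le_mul_of_nonneg_left (ha n le_rfl) (norm_nonneg _)
        · refine (norm_sum_le _ _).trans (Finset.sum_le_sum fun i hi => ?_)
          rw [norm_mul]
          have hi' : i + 1 ≤ n := by have := Finset.mem_range.mp hi; omega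
          exact mul_le_mul_of_nonneg_left (ha (i + 1) hi') (norm_nonneg _)
    _ = M * (‖w (n - 1)‖ + ∑ i ∈ Finset.range (n - 1), ‖w (i + 1) - w i‖) := by
        rw [← Finset.sum_mul]; ring

/-- The variation of a product of three factors of norm `≤ 1` is at most the sum of the
variations. [folklore] -/
theorem norm_mul_mul_sub_mul_mul_le {a b c a' b' c' : ℂ} (hb : ‖b‖ ≤ 1)
    (hc : ‖c‖ ≤ 1) (ha' : ‖a'‖ ≤ 1) (hb' : ‖b'‖ ≤ 1) :
    ‖a * b * c - a' * b' * c'‖ ≤ ‖a - a'‖ + ‖b - b'‖ + ‖c - c'‖ := by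
  have h : a * b * c - a' * b' * c' = (a - a') * b * c + a' * (b - b') * c + a' * b' * (c - c') := by
    ring
  rw [h]
  calc ‖(a - a') * b * c + a' * (b - b') * c + a' * b' * (c - c')‖
      ≤ ‖(a - a') * b * c‖ + ‖a' * (b - b') * c‖ + ‖a' * b' * (c - c')‖ := norm_add₃_le
    _ ≤ ‖a - a'‖ * 1 * 1 + 1 * ‖b - b'‖ * 1 + 1 * 1 * ‖c - c'‖ := by
        rw [norm_mul, norm_mul, norm_mul, norm_mul, norm_mul, norm_mul]
        gcongr
    _ = ‖a - a'‖ + ‖b - b'‖ + ‖c - c'‖ := by ring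

/-- A monotone `{0,1}`-valued sequence has total variation at most `1`. [folklore] -/
theorem sum_norm_indicator_succ_sub_le_of_monotone {n : ℕ} (P : ℕ → Prop) [DecidablePred P]
    (hP : ∀ i, i + 1 < n → P i → P (i + 1)) :
    ∑ i ∈ Finset.range (n - 1),
      ‖(if P (i + 1) then (1 : ℂ) else 0) - (if P i then (1 : ℂ) else 0)‖ ≤ 1 := by
  set f : ℕ → ℝ := fun i => if P i then 1 else 0 with hf
  have hterm : ∀ i ∈ Finset.range (n - 1),
      ‖(if P (i + 1) then (1 : ℂ) else 0) - (if P i then (1 : ℂ) else 0)‖ = f (i + 1) - f i := by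
    intro i hi
    have hi' : i + 1 < n := by have := Finset.mem_range.mp hi; omega
    by_cases h0 : P i
    · rw [if_pos h0, if_pos (hP i hi' h0), hf]; simp [h0, hP i hi' h0]
    · by_cases h1 : P (i + 1)
      · rw [if_pos h1, if_neg h0, hf]; simp [h0, h1]
      · rw [if_neg h1, if_neg h0, hf]; simp [h0, h1]
  rw [Finset.sum_congr rfl hterm, Finset.sum_range_sub]
  have h1 : f (n - 1) ≤ 1 := by simp only [hf]; split_ifs <;> norm_num
  have h2 : 0 ≤ f 0 := by simp only [hf]; split_ifs <;> norm_num
  linarith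

/-- An antitone `{0,1}`-valued sequence has total variation at most `1`. [folklore] -/
theorem sum_norm_indicator_succ_sub_le_of_antitone {n : ℕ} (P : ℕ → Prop) [DecidablePred P]
    (hP : ∀ i, i + 1 < n → P (i + 1) → P i) :
    ∑ i ∈ Finset.range (n - 1),
      ‖(if P (i + 1) then (1 : ℂ) else 0) - (if P i then (1 : ℂ) else 0)‖ ≤ 1 := by
  set f : ℕ → ℝ := fun i => if P i then 1 else 0 with hf
  have hterm : ∀ i ∈ Finset.range (n - 1),
      ‖(if P (i + 1) then (1 : ℂ) else 0) - (if P i then (1 : ℂ) else 0)‖ = f i - f (i + 1) := by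
    intro i hi
    have hi' : i + 1 < n := by have := Finset.mem_range.mp hi; omega
    by_cases h1 : P (i + 1)
    · rw [if_pos h1, if_pos (hP i hi' h1), hf]; simp [h1, hP i hi' h1]
    · by_cases h0 : P i
      · rw [if_neg h1, if_pos h0, hf]; simp [h0, h1]
      · rw [if_neg h1, if_neg h0, hf]; simp [h0, h1]
  rw [Finset.sum_congr rfl hterm, Finset.sum_range_sub']
  have h1 : 0 ≤ f (n - 1) := by simp only [hf]; split_ifs <;> norm_num
  have h2 : f 0 ≤ 1 := by simp only [hf]; split_ifs <;> norm_num
  linarith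

/-- `‖e(x) − e(y)‖ ≤ 2π |x − y|` (a local copy of
`CircleMethodMajorArcs.norm_fourierChar_sub_fourierChar_le`, whose file would import the
Bombieri–Vinogradov reduction into this one). [folklore] -/
theorem norm_fourierChar_sub_le (x y : ℝ) : ‖(𝐞 x : ℂ) - 𝐞 y‖ ≤ 2 * Real.pi * |x - y| := by
  have h : (𝐞 x : ℂ) - 𝐞 y = 𝐞 y * (𝐞 (x - y) - 1) := by
    rw [mul_sub, mul_one, ← Circle.coe_mul, ← AddChar.map_add_eq_mul, add_sub_cancel]
  rw [h, norm_mul, norm_fourierChar, one_mul, Vinogradov.norm_fourierChar_sub_one]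
  have := Real.abs_sin_le_abs (x := Real.pi * (x - y))
  rw [abs_mul, abs_of_pos Real.pi_pos] at this
  linarith

/-- The phase `φ(r) = r/(s (r² + s²))` of the twist `e(−h r/(s D))` varies slowly:
`|φ(r+1) − φ(r)| ≤ 2/s³` for every integer `r` and `s ≥ 1`. [folklore] -/
theorem abs_twistPhase_succ_sub_le {s : ℝ} (hs : 1 ≤ s) (r : ℝ) :
    |(r + 1) / (s * ((r + 1) ^ 2 + s ^ 2)) - r / (s * (r ^ 2 + s ^ 2))| ≤ 2 / s ^ 3 := by
  have hs0 : 0 < s := by linarith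
  have hA : 0 < r ^ 2 + s ^ 2 := by positivity
  have hB : 0 < (r + 1) ^ 2 + s ^ 2 := by positivity
  have hdiff : (r + 1) / (s * ((r + 1) ^ 2 + s ^ 2)) - r / (s * (r ^ 2 + s ^ 2)) =
      (s ^ 2 - r ^ 2 - r) / (s * (r ^ 2 + s ^ 2) * ((r + 1) ^ 2 + s ^ 2)) := by
    field_simp
    ring
  have hden : 0 < s * (r ^ 2 + s ^ 2) * ((r + 1) ^ 2 + s ^ 2) := by positivity
  rw [hdiff, abs_div, abs_of_pos hden]
  rw [div_le_div_iff₀ hden (by positivity)]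
  -- `|s² − r² − r| · s³ ≤ 2 s (r² + s²)((r+1)² + s²)`
  have hnum : |s ^ 2 - r ^ 2 - r| ≤ s ^ 2 + r ^ 2 + |r| := by
    have := abs_sub (s ^ 2 - r ^ 2) r
    have h2 : |s ^ 2 - r ^ 2| ≤ s ^ 2 + r ^ 2 := by
      rw [abs_le]; constructor <;> nlinarith [sq_nonneg r, sq_nonneg s]
    linarith
  have hr : |r| ≤ r ^ 2 + s ^ 2 := by
    rcases le_or_gt 1 |r| with h | h
    · calc |r| ≤ |r| ^ 2 := by nlinarith
        _ = r ^ 2 := sq_abs r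
        _ ≤ r ^ 2 + s ^ 2 := by nlinarith
    · nlinarith [abs_nonneg r, sq_nonneg r]
  have hB1 : s ^ 2 ≤ (r + 1) ^ 2 + s ^ 2 := by nlinarith [sq_nonneg (r + 1)]
  calc |s ^ 2 - r ^ 2 - r| * s ^ 3 ≤ (s ^ 2 + r ^ 2 + |r|) * s ^ 3 := by gcongr
    _ ≤ (2 * (r ^ 2 + s ^ 2)) * s ^ 3 := by gcongr; linarith
    _ = 2 * (s * (r ^ 2 + s ^ 2) * s ^ 2) := by ring
    _ ≤ 2 * (s * (r ^ 2 + s ^ 2) * ((r + 1) ^ 2 + s ^ 2)) := by gcongr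

/-- The twist factor `g(r) = e(−h r/(s(r² + s²)))`. [cite: IwaniecInventiones1978, §4 p. 180] -/
def twist (h : ℤ) (s : ℕ) (r : ℤ) : ℂ :=
  (𝐞 (-((h : ℝ) * r / (s * ((r : ℝ) ^ 2 + (s : ℝ) ^ 2)))) : ℂ)

/-- `‖g(r)‖ = 1`. [folklore] -/
theorem norm_twist (h : ℤ) (s : ℕ) (r : ℤ) : ‖twist h s r‖ = 1 := norm_fourierChar _

/-- `‖g(r+1) − g(r)‖ ≤ 4π |h| / s³` (`s ≥ 1`). [folklore] -/
theorem norm_twist_succ_sub_le (h : ℤ) {s : ℕ} (hs : 1 ≤ s) (r : ℤ) :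
    ‖twist h s (r + 1) - twist h s r‖ ≤ 4 * Real.pi * |(h : ℝ)| / (s : ℝ) ^ 3 := by
  unfold twist
  have hs' : (1 : ℝ) ≤ s := by exact_mod_cast hs
  refine (norm_fourierChar_sub_le _ _).trans ?_
  have key := abs_twistPhase_succ_sub_le hs' (r : ℝ)
  have heq : -((h : ℝ) * ((r + 1 : ℤ) : ℝ) / (s * ((((r + 1 : ℤ) : ℝ)) ^ 2 + (s : ℝ) ^ 2))) -
      -((h : ℝ) * r / (s * ((r : ℝ) ^ 2 + (s : ℝ) ^ 2))) =
      -(h : ℝ) * (((r : ℝ) + 1) / (s * (((r : ℝ) + 1) ^ 2 + (s : ℝ) ^ 2)) -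
        r / (s * ((r : ℝ) ^ 2 + (s : ℝ) ^ 2))) := by
    push_cast; ring
  rw [heq, abs_mul, abs_neg]
  have hs3 : (0 : ℝ) < (s : ℝ) ^ 3 := by positivity
  calc 2 * Real.pi * (|(h : ℝ)| * |((r : ℝ) + 1) / (s * (((r : ℝ) + 1) ^ 2 + (s : ℝ) ^ 2)) -
        r / (s * ((r : ℝ) ^ 2 + (s : ℝ) ^ 2))|)
      ≤ 2 * Real.pi * (|(h : ℝ)| * (2 / (s : ℝ) ^ 3)) := by
        gcongr
    _ = 4 * Real.pi * |(h : ℝ)| / (s : ℝ) ^ 3 := by ring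

/-- **Core of the incomplete Kloosterman estimate with a slowly varying weight.**  If the partial
sums of `a` are bounded by `M`, `P₁, P₂` are each monotone or antitone along the range, and `g`
has norm `≤ 1` and increments `≤ V`, then
`‖∑_{i<n} a_i [P₁ i][P₂ i] g_i‖ ≤ M (3 + n V)`. [folklore] -/
theorem norm_sum_mul_indicator_mul_le {n : ℕ} {a g : ℕ → ℂ} (P₁ P₂ : ℕ → Prop)
    [DecidablePred P₁] [DecidablePred P₂] {M V : ℝ} (hM : 0 ≤ M)
    (ha : ∀ k, k ≤ n → ‖∑ i ∈ Finset.range k, a i‖ ≤ M)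
    (h₁ : (∀ i, i + 1 < n → P₁ i → P₁ (i + 1)) ∨ (∀ i, i + 1 < n → P₁ (i + 1) → P₁ i))
    (h₂ : (∀ i, i + 1 < n → P₂ i → P₂ (i + 1)) ∨ (∀ i, i + 1 < n → P₂ (i + 1) → P₂ i))
    (hg : ∀ i, ‖g i‖ ≤ 1) (hV : 0 ≤ V) (hdg : ∀ i, i + 1 < n → ‖g (i + 1) - g i‖ ≤ V) :
    ‖∑ i ∈ Finset.range n,
        a i * ((if P₁ i then (1 : ℂ) else 0) * (if P₂ i then (1 : ℂ) else 0) * g i)‖ ≤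
      M * (3 + n * V) := by
  set w : ℕ → ℂ := fun i => (if P₁ i then (1 : ℂ) else 0) * (if P₂ i then (1 : ℂ) else 0) * g i
    with hw
  have hind : ∀ (P : Prop) [Decidable P], ‖(if P then (1 : ℂ) else 0)‖ ≤ 1 := by
    intro P _; split_ifs <;> simp
  have hwn : ∀ i, ‖w i‖ ≤ 1 := by
    intro i
    rw [hw]; dsimp only
    rw [norm_mul, norm_mul]
    calc ‖(if P₁ i then (1 : ℂ) else 0)‖ * ‖(if P₂ i then (1 : ℂ) else 0)‖ * ‖g i‖
        ≤ 1 * 1 * 1 := by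
          gcongr
          · exact hind (P₁ i)
          · exact hind (P₂ i)
          · exact hg i
      _ = 1 := by norm_num
  have hAbel := norm_sum_mul_le_of_partialSums (w := w) ha
  refine hAbel.trans ?_
  refine mul_le_mul_of_nonneg_left ?_ hM
  -- total variation of `w`
  have hTV : ∑ i ∈ Finset.range (n - 1), ‖w (i + 1) - w i‖ ≤ 1 + 1 + n * V := by
    have hle : ∀ i ∈ Finset.range (n - 1), ‖w (i + 1) - w i‖ ≤
        ‖(if P₁ (i + 1) then (1 : ℂ) else 0) - (if P₁ i then (1 : ℂ) else 0)‖ +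
        ‖(if P₂ (i + 1) then (1 : ℂ) else 0) - (if P₂ i then (1 : ℂ) else 0)‖ +
        ‖g (i + 1) - g i‖ := by
      intro i _
      rw [hw]
      exact norm_mul_mul_sub_mul_mul_le (hind _) (hg _) (hind _) (hind _)
    refine (Finset.sum_le_sum hle).trans ?_
    rw [Finset.sum_add_distrib, Finset.sum_add_distrib]
    have hA : ∑ i ∈ Finset.range (n - 1),
        ‖(if P₁ (i + 1) then (1 : ℂ) else 0) - (if P₁ i then (1 : ℂ) else 0)‖ ≤ 1 := by
      rcases h₁ with h | h
      · exact sum_norm_indicator_succ_sub_le_of_monotone P₁ h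
      · exact sum_norm_indicator_succ_sub_le_of_antitone P₁ h
    have hB : ∑ i ∈ Finset.range (n - 1),
        ‖(if P₂ (i + 1) then (1 : ℂ) else 0) - (if P₂ i then (1 : ℂ) else 0)‖ ≤ 1 := by
      rcases h₂ with h | h
      · exact sum_norm_indicator_succ_sub_le_of_monotone P₂ h
      · exact sum_norm_indicator_succ_sub_le_of_antitone P₂ h
    have hC : ∑ i ∈ Finset.range (n - 1), ‖g (i + 1) - g i‖ ≤ n * V := by
      calc ∑ i ∈ Finset.range (n - 1), ‖g (i + 1) - g i‖
          ≤ ∑ i ∈ Finset.range (n - 1), V :=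
            Finset.sum_le_sum fun i hi => hdg i (by have := Finset.mem_range.mp hi; omega)
        _ = (n - 1 : ℕ) * V := by rw [Finset.sum_const, Finset.card_range, nsmul_eq_mul]
        _ ≤ n * V := by
            refine mul_le_mul_of_nonneg_right ?_ hV
            exact_mod_cast Nat.sub_le n 1
    linarith
  linarith [hwn (n - 1)]

section Halves

variable {ε C : ℝ}

/-- **The positive half** `0 < r < s` of a class sum: Lemma 6 for the partial sums and Abel
summation against the annulus indicator and the twist.  Here `hC` is the conclusion of Lemma 6
for the exponent `ε` with constant `C`. [cite: IwaniecInventiones1978, §4 p. 180] -/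
theorem norm_sum_Ioo_pos_le
    (hC : ∀ (s Λ : ℕ) (h r₁ r₂ lam : ℤ), 1 ≤ s → 1 ≤ Λ → r₁ < r₂ → r₂ - r₁ < 2 * s →
      ‖∑ r ∈ (Finset.Ioo r₁ r₂).filter (fun r : ℤ => Int.gcd r s = 1 ∧ r ≡ lam [ZMOD Λ]),
          hooleyPhase h s r‖ ≤ C * (s : ℝ) ^ (1 / 2 + ε) * Real.sqrt (Int.gcd h s))
    {s Λ : ℕ} (hs : 2 ≤ s) (hΛ : 1 ≤ Λ) (h lam T₁ T₂ : ℤ) :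
    ‖∑ r ∈ (Finset.Ioo (0 : ℤ) s).filter (fun r : ℤ => Int.gcd r s = 1 ∧ r ≡ lam [ZMOD Λ] ∧
        T₁ < r ^ 2 + (s : ℤ) ^ 2 ∧ r ^ 2 + (s : ℤ) ^ 2 ≤ T₂), hooleyPhase h s r * twist h s r‖ ≤
      C * (s : ℝ) ^ (1 / 2 + ε) * Real.sqrt (Int.gcd h s) *
        (3 + 4 * Real.pi * |(h : ℝ)| / (s : ℝ) ^ 2) := by
  set M : ℝ := C * (s : ℝ) ^ (1 / 2 + ε) * Real.sqrt (Int.gcd h s) with hMdef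
  -- the index change `r = i + 1`, `i < s - 1`
  set ρ : ℕ → ℤ := fun i => (i : ℤ) + 1 with hρ
  have himage : ∀ k : ℕ, k + 1 ≤ s → Finset.Ioo (0 : ℤ) (k + 1 : ℕ) = (Finset.range k).image ρ := by
    intro k _
    ext x
    simp only [Finset.mem_Ioo, Finset.mem_image, Finset.mem_range, hρ]
    constructor
    · rintro ⟨h0, hk⟩
      refine ⟨(x - 1).toNat, ?_, ?_⟩
      · have : ((x - 1).toNat : ℤ) = x - 1 := Int.toNat_of_nonneg (by omega)
        omega
      · have : ((x - 1).toNat : ℤ) = x - 1 := Int.toNat_of_nonneg (by omega)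
        omega
    · rintro ⟨i, hi, rfl⟩
      constructor <;> omega
  have hinj : ∀ k : ℕ, Set.InjOn ρ (Finset.range k : Set ℕ) := by
    intro k i _ j _ hij
    simp only [hρ] at hij
    exact_mod_cast (add_right_cancel hij)
  -- the sequences
  set a : ℕ → ℂ := fun i => if Int.gcd (ρ i) s = 1 ∧ ρ i ≡ lam [ZMOD Λ] then hooleyPhase h s (ρ i)
    else 0 with hadef
  set g : ℕ → ℂ := fun i => twist h s (ρ i) with hgdef
  set P₁ : ℕ → Prop := fun i => T₁ < ρ i ^ 2 + (s : ℤ) ^ 2 with hP₁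
  set P₂ : ℕ → Prop := fun i => ρ i ^ 2 + (s : ℤ) ^ 2 ≤ T₂ with hP₂
  -- partial sums via Lemma 6
  have hM0 : 0 ≤ M := by
    have := hC s Λ h 0 1 lam (by omega) hΛ zero_lt_one (by push_cast; omega)
    exact (norm_nonneg _).trans this
  have hpartial : ∀ k, k ≤ s - 1 → ‖∑ i ∈ Finset.range k, a i‖ ≤ M := by
    intro k hk
    have hk' : k + 1 ≤ s := by omega
    have heq : ∑ i ∈ Finset.range k, a i =
        ∑ r ∈ (Finset.Ioo (0 : ℤ) (k + 1 : ℕ)).filter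
          (fun r : ℤ => Int.gcd r s = 1 ∧ r ≡ lam [ZMOD Λ]), hooleyPhase h s r := by
      rw [Finset.sum_filter, himage k hk', Finset.sum_image (hinj k)]
    rw [heq]
    have := hC s Λ h 0 ((k + 1 : ℕ) : ℤ) lam (by omega) hΛ (by push_cast; omega)
      (by push_cast; omega)
    exact this
  -- rewrite the sum as `∑_{i < s-1} a i * w i`
  have hsum : ∑ r ∈ (Finset.Ioo (0 : ℤ) s).filter (fun r : ℤ => Int.gcd r s = 1 ∧
        r ≡ lam [ZMOD Λ] ∧ T₁ < r ^ 2 + (s : ℤ) ^ 2 ∧ r ^ 2 + (s : ℤ) ^ 2 ≤ T₂),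
        hooleyPhase h s r * twist h s r =
      ∑ i ∈ Finset.range (s - 1),
        a i * ((if P₁ i then (1 : ℂ) else 0) * (if P₂ i then (1 : ℂ) else 0) * g i) := by
    have hs' : Finset.Ioo (0 : ℤ) s = Finset.Ioo (0 : ℤ) ((s - 1 : ℕ) + 1 : ℕ) := by
      congr 1; push_cast; omega
    rw [Finset.sum_filter, hs', himage (s - 1) (by omega), Finset.sum_image (hinj _)]
    refine Finset.sum_congr rfl fun i _ => ?_
    simp only [hadef, hgdef, hP₁, hP₂]
    by_cases hc1 : Int.gcd (ρ i) s = 1 ∧ ρ i ≡ lam [ZMOD Λ]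
    · by_cases hc2 : T₁ < ρ i ^ 2 + (s : ℤ) ^ 2
      · by_cases hc3 : ρ i ^ 2 + (s : ℤ) ^ 2 ≤ T₂
        · rw [if_pos ⟨hc1.1, hc1.2, hc2, hc3⟩, if_pos hc1, if_pos hc2, if_pos hc3]; ring
        · rw [if_neg (fun h => hc3 h.2.2.2), if_neg hc3]; ring
      · rw [if_neg (fun h => hc2 h.2.2.1), if_neg hc2]; ring
    · rw [if_neg (fun h => hc1 ⟨h.1, h.2.1⟩), if_neg hc1]; ring
  rw [hsum]
  have hs1 : (1 : ℝ) ≤ s := by exact_mod_cast (by omega : 1 ≤ s)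
  have hcore := norm_sum_mul_indicator_mul_le (n := s - 1) (a := a) (g := g) P₁ P₂ hM0 hpartial
    (Or.inl fun i _ hP => ?_) (Or.inr fun i _ hP => ?_) (fun i => by rw [hgdef]; exact (norm_twist _ _ _).le)
    (V := 4 * Real.pi * |(h : ℝ)| / (s : ℝ) ^ 3) (by positivity)
    (fun i _ => by
      rw [hgdef]; dsimp only
      rw [show ρ (i + 1) = ρ i + 1 by simp only [hρ]; push_cast; ring]
      exact norm_twist_succ_sub_le h (by omega) (ρ i))
  · refine hcore.trans ?_
    refine mul_le_mul_of_nonneg_left ?_ hM0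
    have hs0 : (0 : ℝ) < s := by linarith
    have : ((s - 1 : ℕ) : ℝ) * (4 * Real.pi * |(h : ℝ)| / (s : ℝ) ^ 3) ≤
        4 * Real.pi * |(h : ℝ)| / (s : ℝ) ^ 2 := by
      have hle : ((s - 1 : ℕ) : ℝ) ≤ s := by exact_mod_cast Nat.sub_le s 1
      calc ((s - 1 : ℕ) : ℝ) * (4 * Real.pi * |(h : ℝ)| / (s : ℝ) ^ 3)
          ≤ (s : ℝ) * (4 * Real.pi * |(h : ℝ)| / (s : ℝ) ^ 3) :=
            mul_le_mul_of_nonneg_right hle (by positivity)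
        _ = 4 * Real.pi * |(h : ℝ)| / (s : ℝ) ^ 2 := by field_simp
    linarith
  · -- `P₁` is monotone along `i ↦ i + 1`
    simp only [hP₁, hρ] at hP ⊢
    push_cast
    nlinarith
  · -- `P₂` is antitone
    simp only [hP₂, hρ] at hP ⊢
    push_cast at hP ⊢
    nlinarith

/-- **The non-positive half** `−s < r ≤ 0` of a class sum (same argument, the annulus
indicators now being antitone/monotone). [cite: IwaniecInventiones1978, §4 p. 180] -/
theorem norm_sum_Ioo_neg_le
    (hC : ∀ (s Λ : ℕ) (h r₁ r₂ lam : ℤ), 1 ≤ s → 1 ≤ Λ → r₁ < r₂ → r₂ - r₁ < 2 * s →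
      ‖∑ r ∈ (Finset.Ioo r₁ r₂).filter (fun r : ℤ => Int.gcd r s = 1 ∧ r ≡ lam [ZMOD Λ]),
          hooleyPhase h s r‖ ≤ C * (s : ℝ) ^ (1 / 2 + ε) * Real.sqrt (Int.gcd h s))
    {s Λ : ℕ} (hs : 2 ≤ s) (hΛ : 1 ≤ Λ) (h lam T₁ T₂ : ℤ) :
    ‖∑ r ∈ (Finset.Ioo (-(s : ℤ)) 1).filter (fun r : ℤ => Int.gcd r s = 1 ∧ r ≡ lam [ZMOD Λ] ∧
        T₁ < r ^ 2 + (s : ℤ) ^ 2 ∧ r ^ 2 + (s : ℤ) ^ 2 ≤ T₂), hooleyPhase h s r * twist h s r‖ ≤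
      C * (s : ℝ) ^ (1 / 2 + ε) * Real.sqrt (Int.gcd h s) *
        (3 + 4 * Real.pi * |(h : ℝ)| / (s : ℝ) ^ 2) := by
  set M : ℝ := C * (s : ℝ) ^ (1 / 2 + ε) * Real.sqrt (Int.gcd h s) with hMdef
  -- the index change `r = i − (s − 1)`, `i < s`
  set ρ : ℕ → ℤ := fun i => (i : ℤ) - ((s : ℤ) - 1) with hρ
  have himage : ∀ k : ℕ, k ≤ s →
      Finset.Ioo (-(s : ℤ)) ((k : ℤ) - ((s : ℤ) - 1)) = (Finset.range k).image ρ := by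
    intro k _
    ext x
    simp only [Finset.mem_Ioo, Finset.mem_image, Finset.mem_range, hρ]
    constructor
    · rintro ⟨h0, hk⟩
      refine ⟨(x + s - 1).toNat, ?_, ?_⟩
      · have : ((x + s - 1).toNat : ℤ) = x + s - 1 := Int.toNat_of_nonneg (by omega)
        omega
      · have : ((x + s - 1).toNat : ℤ) = x + s - 1 := Int.toNat_of_nonneg (by omega)
        omega
    · rintro ⟨i, hi, rfl⟩
      constructor <;> omega
  have hinj : ∀ k : ℕ, Set.InjOn ρ (Finset.range k : Set ℕ) := by
    intro k i _ j _ hij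
    simp only [hρ] at hij
    exact_mod_cast (sub_left_injective hij)
  set a : ℕ → ℂ := fun i => if Int.gcd (ρ i) s = 1 ∧ ρ i ≡ lam [ZMOD Λ] then hooleyPhase h s (ρ i)
    else 0 with hadef
  set g : ℕ → ℂ := fun i => twist h s (ρ i) with hgdef
  set P₁ : ℕ → Prop := fun i => T₁ < ρ i ^ 2 + (s : ℤ) ^ 2 with hP₁
  set P₂ : ℕ → Prop := fun i => ρ i ^ 2 + (s : ℤ) ^ 2 ≤ T₂ with hP₂
  have hM0 : 0 ≤ M := by
    have := hC s Λ h 0 1 lam (by omega) hΛ zero_lt_one (by push_cast; omega)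
    exact (norm_nonneg _).trans this
  have hpartial : ∀ k, k ≤ s → ‖∑ i ∈ Finset.range k, a i‖ ≤ M := by
    intro k hk
    have heq : ∑ i ∈ Finset.range k, a i =
        ∑ r ∈ (Finset.Ioo (-(s : ℤ)) ((k : ℤ) - ((s : ℤ) - 1))).filter
          (fun r : ℤ => Int.gcd r s = 1 ∧ r ≡ lam [ZMOD Λ]), hooleyPhase h s r := by
      rw [Finset.sum_filter, himage k hk, Finset.sum_image (hinj k)]
    rw [heq]
    exact hC s Λ h (-(s : ℤ)) ((k : ℤ) - ((s : ℤ) - 1)) lam (by omega) hΛ (by omega) (by omega)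
  have hsum : ∑ r ∈ (Finset.Ioo (-(s : ℤ)) 1).filter (fun r : ℤ => Int.gcd r s = 1 ∧
        r ≡ lam [ZMOD Λ] ∧ T₁ < r ^ 2 + (s : ℤ) ^ 2 ∧ r ^ 2 + (s : ℤ) ^ 2 ≤ T₂),
        hooleyPhase h s r * twist h s r =
      ∑ i ∈ Finset.range s,
        a i * ((if P₁ i then (1 : ℂ) else 0) * (if P₂ i then (1 : ℂ) else 0) * g i) := by
    have hs' : Finset.Ioo (-(s : ℤ)) 1 = Finset.Ioo (-(s : ℤ)) ((s : ℤ) - ((s : ℤ) - 1)) := by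
      congr 1; ring
    rw [Finset.sum_filter, hs', himage s le_rfl, Finset.sum_image (hinj _)]
    refine Finset.sum_congr rfl fun i _ => ?_
    simp only [hadef, hgdef, hP₁, hP₂]
    by_cases hc1 : Int.gcd (ρ i) s = 1 ∧ ρ i ≡ lam [ZMOD Λ]
    · by_cases hc2 : T₁ < ρ i ^ 2 + (s : ℤ) ^ 2
      · by_cases hc3 : ρ i ^ 2 + (s : ℤ) ^ 2 ≤ T₂
        · rw [if_pos ⟨hc1.1, hc1.2, hc2, hc3⟩, if_pos hc1, if_pos hc2, if_pos hc3]; ring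
        · rw [if_neg (fun h => hc3 h.2.2.2), if_neg hc3]; ring
      · rw [if_neg (fun h => hc2 h.2.2.1), if_neg hc2]; ring
    · rw [if_neg (fun h => hc1 ⟨h.1, h.2.1⟩), if_neg hc1]; ring
  rw [hsum]
  have hcore := norm_sum_mul_indicator_mul_le (n := s) (a := a) (g := g) P₁ P₂ hM0 hpartial
    (Or.inr fun i hi hP => ?_) (Or.inl fun i hi hP => ?_)
    (fun i => by rw [hgdef]; exact (norm_twist _ _ _).le)
    (V := 4 * Real.pi * |(h : ℝ)| / (s : ℝ) ^ 3) (by positivity)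
    (fun i _ => by
      rw [hgdef]; dsimp only
      rw [show ρ (i + 1) = ρ i + 1 by simp only [hρ]; push_cast; ring]
      exact norm_twist_succ_sub_le h (by omega) (ρ i))
  · refine hcore.trans ?_
    refine mul_le_mul_of_nonneg_left ?_ hM0
    have hs0 : (0 : ℝ) < s := by exact_mod_cast (by omega : 0 < s)
    have : (s : ℝ) * (4 * Real.pi * |(h : ℝ)| / (s : ℝ) ^ 3) =
        4 * Real.pi * |(h : ℝ)| / (s : ℝ) ^ 2 := by field_simp
    linarith
  · -- `P₁` is antitone: `ρ i ≤ ρ (i+1) ≤ 0`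
    simp only [hP₁, hρ] at hP ⊢
    push_cast at hP ⊢
    have hi' : (i : ℤ) + 1 < s := by exact_mod_cast hi
    nlinarith
  · -- `P₂` is monotone
    simp only [hP₂, hρ] at hP ⊢
    push_cast at hP ⊢
    have hi' : (i : ℤ) + 1 < s := by exact_mod_cast hi
    nlinarith

/-- **A full class sum** `−s < r < s`: at most twice the half bound.
[cite: IwaniecInventiones1978, §4 p. 180] -/
theorem norm_sum_Ioo_class_le
    (hC : ∀ (s Λ : ℕ) (h r₁ r₂ lam : ℤ), 1 ≤ s → 1 ≤ Λ → r₁ < r₂ → r₂ - r₁ < 2 * s →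
      ‖∑ r ∈ (Finset.Ioo r₁ r₂).filter (fun r : ℤ => Int.gcd r s = 1 ∧ r ≡ lam [ZMOD Λ]),
          hooleyPhase h s r‖ ≤ C * (s : ℝ) ^ (1 / 2 + ε) * Real.sqrt (Int.gcd h s))
    {s Λ : ℕ} (hs : 2 ≤ s) (hΛ : 1 ≤ Λ) (h lam T₁ T₂ : ℤ) :
    ‖∑ r ∈ (Finset.Ioo (-(s : ℤ)) s).filter (fun r : ℤ => Int.gcd r s = 1 ∧ r ≡ lam [ZMOD Λ] ∧
        T₁ < r ^ 2 + (s : ℤ) ^ 2 ∧ r ^ 2 + (s : ℤ) ^ 2 ≤ T₂), hooleyPhase h s r * twist h s r‖ ≤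
      2 * (C * (s : ℝ) ^ (1 / 2 + ε) * Real.sqrt (Int.gcd h s) *
        (3 + 4 * Real.pi * |(h : ℝ)| / (s : ℝ) ^ 2)) := by
  have hsplit : Finset.Ioo (-(s : ℤ)) s = Finset.Ioo (-(s : ℤ)) 1 ∪ Finset.Ioo (0 : ℤ) s := by
    ext x; simp only [Finset.mem_union, Finset.mem_Ioo]; omega
  have hdisj : Disjoint (Finset.Ioo (-(s : ℤ)) 1) (Finset.Ioo (0 : ℤ) s) := by
    rw [Finset.disjoint_left]; intro x hx hx'
    rw [Finset.mem_Ioo] at hx hx'; omega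
  rw [hsplit, Finset.filter_union, Finset.sum_union (Finset.disjoint_filter_filter hdisj)]
  refine (norm_add_le _ _).trans ?_
  have h1 := norm_sum_Ioo_neg_le hC hs hΛ h lam T₁ T₂
  have h2 := norm_sum_Ioo_pos_le hC hs hΛ h lam T₁ T₂
  linarith

end Halves

/-! ### Counting the admissible residue classes -/

/-- `#{λ mod n : n ∣ λ² + s²} = ρ(n)` when `(s, n) = 1` (scale by `s⁻¹`). [folklore] -/
theorem card_filter_range_dvd_sq_add_sq {n s : ℕ} (hn : 0 < n) (hsn : Nat.Coprime s n) :
    ((Finset.range n).filter (fun lam : ℕ => (n : ℤ) ∣ (lam : ℤ) ^ 2 + (s : ℤ) ^ 2)).card = rho n := by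
  classical
  haveI : NeZero n := ⟨hn.ne'⟩
  rw [rho_eq_card_filter_zmod]
  have hu : IsUnit (s : ZMod n) := (ZMod.isUnit_iff_coprime s n).mpr hsn
  -- `range n → ZMod n`, `λ ↦ λ s⁻¹`
  refine Finset.card_bij (fun lam _ => (lam : ZMod n) * (hu.unit⁻¹ : (ZMod n)ˣ)) ?_ ?_ ?_
  · intro lam hlam
    rw [Finset.mem_filter, Finset.mem_range] at hlam
    rw [Finset.mem_filter]
    refine ⟨Finset.mem_univ _, ?_⟩
    have h0 : ((lam : ℤ) ^ 2 + (s : ℤ) ^ 2 : ℤ) = ((((lam : ℤ) ^ 2 + (s : ℤ) ^ 2 : ℤ)) : ℤ) := rfl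
    have hz : (((lam : ℤ) ^ 2 + (s : ℤ) ^ 2 : ℤ) : ZMod n) = 0 :=
      (ZMod.intCast_zmod_eq_zero_iff_dvd _ n).mpr hlam.2
    push_cast at hz
    have hinv : (s : ZMod n) * (hu.unit⁻¹ : (ZMod n)ˣ) = 1 := IsUnit.mul_val_inv hu
    calc ((lam : ZMod n) * (hu.unit⁻¹ : (ZMod n)ˣ)) ^ 2 + 1
        = ((lam : ZMod n) ^ 2 + (s : ZMod n) ^ 2) * ((hu.unit⁻¹ : (ZMod n)ˣ) : ZMod n) ^ 2 := by
          rw [show (1 : ZMod n) = ((s : ZMod n) * (hu.unit⁻¹ : (ZMod n)ˣ)) ^ 2 by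
            rw [hinv, one_pow]]
          ring
      _ = 0 := by rw [hz, zero_mul]
  · intro a ha b hb hab
    rw [Finset.mem_filter, Finset.mem_range] at ha hb
    have hab' : (a : ZMod n) = (b : ZMod n) := by
      have := congrArg (· * (s : ZMod n)) hab
      simpa only [mul_assoc, IsUnit.val_inv_mul, mul_one] using this
    have := (ZMod.natCast_eq_natCast_iff' a b n).mp hab'
    rwa [Nat.mod_eq_of_lt ha.1, Nat.mod_eq_of_lt hb.1] at this
  · intro y hy
    rw [Finset.mem_filter] at hy
    refine ⟨(y * (s : ZMod n)).val, ?_, ?_⟩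
    · rw [Finset.mem_filter, Finset.mem_range]
      refine ⟨ZMod.val_lt _, ?_⟩
      rw [← ZMod.intCast_zmod_eq_zero_iff_dvd]
      push_cast
      rw [ZMod.natCast_zmod_val]
      calc (y * (s : ZMod n)) ^ 2 + (s : ZMod n) ^ 2 = (y ^ 2 + 1) * (s : ZMod n) ^ 2 := by ring
        _ = 0 := by rw [hy.2, zero_mul]
    · rw [ZMod.natCast_zmod_val, mul_assoc, IsUnit.mul_val_inv, mul_one]

/-- Periodicity: `#{λ < n d : n ∣ λ² + s²} = d · #{λ < n : n ∣ λ² + s²}`. [folklore] -/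
theorem card_filter_range_mul_dvd_sq_add_sq (n d : ℕ) (s : ℤ) :
    ((Finset.range (n * d)).filter (fun lam : ℕ => (n : ℤ) ∣ (lam : ℤ) ^ 2 + s ^ 2)).card =
      d * ((Finset.range n).filter (fun lam : ℕ => (n : ℤ) ∣ (lam : ℤ) ^ 2 + s ^ 2)).card := by
  classical
  have hper : Function.Periodic (fun lam : ℕ => (n : ℤ) ∣ (lam : ℤ) ^ 2 + s ^ 2) n := by
    intro lam
    have e : ((lam + n : ℕ) : ℤ) ^ 2 + s ^ 2 = (n : ℤ) * (2 * lam + n) + ((lam : ℤ) ^ 2 + s ^ 2) := by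
      push_cast; ring
    simp only [e, eq_iff_iff]
    exact dvd_add_right (dvd_mul_right _ _)
  induction d with
  | zero => simp
  | succ d ih =>
    rw [Nat.mul_succ, Finset.range_eq_Ico, ← Finset.Ico_union_Ico_eq_Ico (Nat.zero_le _)
      (Nat.le_add_right _ _), Finset.filter_union, Finset.card_union_of_disjoint
      (Finset.disjoint_filter_filter (Finset.Ico_disjoint_Ico_consecutive _ _ _)),
      ← Finset.range_eq_Ico, ih, Nat.filter_Ico_card_eq_of_periodic _ _ _ hper,
      Nat.count_eq_card_filter_range]
    ring

section Classes

variable {ε C : ℝ}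

/-- **The `r`-sum for fixed `s` and `l`**, split into residue classes modulo `Λ = l q d`: the
three congruence conditions (`lq ∣ r² + s²`, `r² + s² ≡ qμ (mod qd)`, `r + ωs ≡ 0 (mod d)`)
depend on `r mod Λ` only, at most `d ρ(lq)` classes are admissible (when `(s, lq) = 1`; otherwise
the sum is empty), and each class contributes at most the class bound.
[cite: IwaniecInventiones1978, §4 p. 180] -/
theorem norm_sum_Ioo_congr_le
    (hC : ∀ (s Λ : ℕ) (h r₁ r₂ lam : ℤ), 1 ≤ s → 1 ≤ Λ → r₁ < r₂ → r₂ - r₁ < 2 * s →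
      ‖∑ r ∈ (Finset.Ioo r₁ r₂).filter (fun r : ℤ => Int.gcd r s = 1 ∧ r ≡ lam [ZMOD Λ]),
          hooleyPhase h s r‖ ≤ C * (s : ℝ) ^ (1 / 2 + ε) * Real.sqrt (Int.gcd h s))
    {s l q d : ℕ} (hs : 2 ≤ s) (hl : 0 < l) (hq : 0 < q) (hd : 0 < d) (h : ℤ) (μ ω : ℕ)
    (T₁ T₂ : ℤ) :
    ‖∑ r ∈ (Finset.Ioo (-(s : ℤ)) s).filter (fun r : ℤ => Int.gcd r s = 1 ∧
        ((l * q : ℕ) : ℤ) ∣ r ^ 2 + (s : ℤ) ^ 2 ∧ r ^ 2 + (s : ℤ) ^ 2 ≡ ((q * μ : ℕ) : ℤ) [ZMOD ((q * d : ℕ) : ℤ)] ∧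
        r + (ω : ℤ) * s ≡ 0 [ZMOD (d : ℤ)] ∧ T₁ < r ^ 2 + (s : ℤ) ^ 2 ∧ r ^ 2 + (s : ℤ) ^ 2 ≤ T₂),
        hooleyPhase h s r * twist h s r‖ ≤
      (d * rho (l * q) : ℕ) * (2 * (C * (s : ℝ) ^ (1 / 2 + ε) * Real.sqrt (Int.gcd h s) *
        (3 + 4 * Real.pi * |(h : ℝ)| / (s : ℝ) ^ 2))) := by
  classical
  set B : ℝ := 2 * (C * (s : ℝ) ^ (1 / 2 + ε) * Real.sqrt (Int.gcd h s) *
    (3 + 4 * Real.pi * |(h : ℝ)| / (s : ℝ) ^ 2)) with hB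
  have hM0 : 0 ≤ C * (s : ℝ) ^ (1 / 2 + ε) * Real.sqrt (Int.gcd h s) := by
    have := hC s 1 h 0 1 0 (by omega) le_rfl zero_lt_one (by push_cast; omega)
    exact (norm_nonneg _).trans this
  have hB0 : 0 ≤ B := by rw [hB]; positivity
  set Λ : ℕ := l * q * d with hΛ
  have hΛ0 : 0 < Λ := Nat.mul_pos (Nat.mul_pos hl hq) hd
  -- the periodic part of the conditions
  set per : ℤ → Prop := fun r => ((l * q : ℕ) : ℤ) ∣ r ^ 2 + (s : ℤ) ^ 2 ∧
    r ^ 2 + (s : ℤ) ^ 2 ≡ ((q * μ : ℕ) : ℤ) [ZMOD ((q * d : ℕ) : ℤ)] ∧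
    r + (ω : ℤ) * s ≡ 0 [ZMOD (d : ℤ)] with hper
  have hper_congr : ∀ r r' : ℤ, r ≡ r' [ZMOD (Λ : ℤ)] → (per r ↔ per r') := by
    -- it suffices to prove one direction, by symmetry
    suffices key : ∀ r r' : ℤ, r ≡ r' [ZMOD (Λ : ℤ)] → per r → per r' by
      intro r r' hrr'
      exact ⟨key r r' hrr', key r' r hrr'.symm⟩
    intro r r' hrr' hp
    obtain ⟨h1, h2, h3⟩ := hp
    have hsq : r ^ 2 + (s : ℤ) ^ 2 ≡ r' ^ 2 + (s : ℤ) ^ 2 [ZMOD (Λ : ℤ)] := (hrr'.pow 2).add_right _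
    have hlq : ((l * q : ℕ) : ℤ) ∣ (Λ : ℤ) := by rw [hΛ]; exact_mod_cast dvd_mul_right (l * q) d
    have hqd : ((q * d : ℕ) : ℤ) ∣ (Λ : ℤ) := by
      rw [hΛ]; exact_mod_cast (Dvd.intro_left l (by ring) : q * d ∣ l * q * d)
    have hdΛ : (d : ℤ) ∣ (Λ : ℤ) := by rw [hΛ]; exact_mod_cast (dvd_mul_left d (l * q))
    refine ⟨?_, ?_, ?_⟩
    · have e := Int.ModEq.of_dvd hlq hsq
      refine Int.dvd_of_emod_eq_zero ?_
      unfold Int.ModEq at e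
      rw [← e]
      exact Int.emod_eq_zero_of_dvd h1
    · exact (Int.ModEq.of_dvd hqd hsq).symm.trans h2
    · have e : r + (ω : ℤ) * s ≡ r' + (ω : ℤ) * s [ZMOD (d : ℤ)] :=
        (Int.ModEq.of_dvd hdΛ hrr').add_right _
      exact e.symm.trans h3
  -- rewrite the summation set with `per`
  set F : ℤ → ℂ := fun r => hooleyPhase h s r * twist h s r with hF
  set T := (Finset.Ioo (-(s : ℤ)) s).filter (fun r : ℤ => Int.gcd r s = 1 ∧ per r ∧
    T₁ < r ^ 2 + (s : ℤ) ^ 2 ∧ r ^ 2 + (s : ℤ) ^ 2 ≤ T₂) with hT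
  have hset : (Finset.Ioo (-(s : ℤ)) s).filter (fun r : ℤ => Int.gcd r s = 1 ∧
        ((l * q : ℕ) : ℤ) ∣ r ^ 2 + (s : ℤ) ^ 2 ∧
        r ^ 2 + (s : ℤ) ^ 2 ≡ ((q * μ : ℕ) : ℤ) [ZMOD ((q * d : ℕ) : ℤ)] ∧
        r + (ω : ℤ) * s ≡ 0 [ZMOD (d : ℤ)] ∧ T₁ < r ^ 2 + (s : ℤ) ^ 2 ∧ r ^ 2 + (s : ℤ) ^ 2 ≤ T₂) = T := by
    rw [hT]
    refine Finset.filter_congr fun r _ => ?_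
    simp only [hper]
    tauto
  rw [hset]
  -- Case 1: `(s, lq) > 1`: the sum is empty.
  by_cases hcop : Nat.Coprime s (l * q)
  swap
  · have hempty : T = ∅ := by
      rw [hT, Finset.filter_eq_empty_iff]
      rintro r - ⟨hgcd, ⟨hdvd, -, -⟩, -⟩
      apply hcop
      set g := Nat.gcd s (l * q) with hg
      have hg1 : (g : ℤ) ∣ (s : ℤ) := by exact_mod_cast Nat.gcd_dvd_left s (l * q)
      have hg2 : (g : ℤ) ∣ ((l * q : ℕ) : ℤ) := by exact_mod_cast Nat.gcd_dvd_right s (l * q)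
      have hg3 : (g : ℤ) ∣ r ^ 2 := by
        have h4 : (g : ℤ) ∣ r ^ 2 + (s : ℤ) ^ 2 := hg2.trans hdvd
        have h5 : (g : ℤ) ∣ (s : ℤ) ^ 2 := dvd_pow hg1 two_ne_zero
        have := dvd_sub h4 h5
        rwa [add_sub_cancel_right] at this
      have hcopr : IsCoprime (r ^ 2) (s : ℤ) := (Int.isCoprime_iff_gcd_eq_one.mpr hgcd).pow_left
      have hunit : IsUnit (g : ℤ) := hcopr.isUnit_of_dvd' hg3 hg1
      have := Int.isUnit_iff_natAbs_eq.mp hunit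
      rwa [Int.natAbs_natCast] at this
    rw [hempty, Finset.sum_empty, norm_zero]
    positivity
  -- Case 2: `(s, lq) = 1`: split into classes modulo `Λ`.
  have hΛpos : (0 : ℤ) < (Λ : ℤ) := by exact_mod_cast hΛ0
  have hmaps : ∀ r ∈ T, (r % (Λ : ℤ)).toNat ∈ Finset.range Λ := by
    intro r _
    rw [Finset.mem_range]
    have h0 : 0 ≤ r % (Λ : ℤ) := Int.emod_nonneg _ hΛpos.ne'
    have h1 : r % (Λ : ℤ) < Λ := Int.emod_lt_of_pos _ hΛpos
    exact (Int.toNat_lt h0).mpr h1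
  rw [← Finset.sum_fiberwise_of_maps_to hmaps]
  refine (norm_sum_le _ _).trans ?_
  -- each fibre
  have hfib : ∀ lam ∈ Finset.range Λ,
      ‖∑ r ∈ T.filter (fun r => (r % (Λ : ℤ)).toNat = lam), F r‖ ≤
        (if per (lam : ℤ) then 1 else 0) * B := by
    intro lam hlam
    rw [Finset.mem_range] at hlam
    have hclass : ∀ r : ℤ, (r % (Λ : ℤ)).toNat = lam ↔ r ≡ (lam : ℤ) [ZMOD (Λ : ℤ)] := by
      intro r
      have h0 : 0 ≤ r % (Λ : ℤ) := Int.emod_nonneg _ hΛpos.ne'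
      rw [Int.ModEq, Int.emod_eq_of_lt (by positivity : (0 : ℤ) ≤ lam) (by exact_mod_cast hlam)]
      constructor
      · intro h
        have := Int.toNat_of_nonneg h0
        rw [h] at this
        exact this.symm
      · intro h
        rw [h]; rfl
    by_cases hp : per (lam : ℤ)
    · rw [if_pos hp, one_mul]
      have hfilter : T.filter (fun r => (r % (Λ : ℤ)).toNat = lam) =
          (Finset.Ioo (-(s : ℤ)) s).filter (fun r : ℤ => Int.gcd r s = 1 ∧
            r ≡ (lam : ℤ) [ZMOD (Λ : ℤ)] ∧ T₁ < r ^ 2 + (s : ℤ) ^ 2 ∧ r ^ 2 + (s : ℤ) ^ 2 ≤ T₂) := by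
        rw [hT, Finset.filter_filter]
        refine Finset.filter_congr fun r _ => ?_
        rw [hclass r]
        constructor
        · rintro ⟨⟨h1, -, h3, h4⟩, h5⟩
          exact ⟨h1, h5, h3, h4⟩
        · rintro ⟨h1, h5, h3, h4⟩
          exact ⟨⟨h1, (hper_congr r lam h5).mpr hp, h3, h4⟩, h5⟩
      rw [hfilter, hB, hF]
      exact norm_sum_Ioo_class_le hC hs hΛ0 h (lam : ℤ) T₁ T₂
    · rw [if_neg hp, zero_mul]
      have hempty : T.filter (fun r => (r % (Λ : ℤ)).toNat = lam) = ∅ := by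
        rw [hT, Finset.filter_filter, Finset.filter_eq_empty_iff]
        rintro r - ⟨⟨-, h2, -, -⟩, h5⟩
        rw [hclass r] at h5
        exact hp ((hper_congr r lam h5).mp h2)
      rw [hempty, Finset.sum_empty, norm_zero]
  -- count the admissible classes
  have hcount : ((Finset.range Λ).filter (fun lam : ℕ => per (lam : ℤ))).card ≤ d * rho (l * q) := by
    have hsub : (Finset.range Λ).filter (fun lam : ℕ => per (lam : ℤ)) ⊆
        (Finset.range (l * q * d)).filter
          (fun lam : ℕ => ((l * q : ℕ) : ℤ) ∣ (lam : ℤ) ^ 2 + (s : ℤ) ^ 2) := by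
      intro lam hlam
      rw [Finset.mem_filter] at hlam ⊢
      exact ⟨hlam.1, hlam.2.1⟩
    refine (Finset.card_le_card hsub).trans ?_
    rw [card_filter_range_mul_dvd_sq_add_sq (l * q) d (s : ℤ),
      card_filter_range_dvd_sq_add_sq (Nat.mul_pos hl hq) hcop]
  calc ∑ lam ∈ Finset.range Λ, ‖∑ r ∈ T.filter (fun r => (r % (Λ : ℤ)).toNat = lam), F r‖
      ≤ ∑ lam ∈ Finset.range Λ, (if per (lam : ℤ) then 1 else 0) * B := Finset.sum_le_sum hfib
    _ = ∑ lam ∈ (Finset.range Λ).filter (fun lam : ℕ => per (lam : ℤ)), B := by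
        rw [Finset.sum_filter]
        refine Finset.sum_congr rfl fun lam _ => ?_
        split_ifs <;> simp
    _ = ((Finset.range Λ).filter (fun lam : ℕ => per (lam : ℤ))).card * B := by
        rw [Finset.sum_const, nsmul_eq_mul]
    _ ≤ (d * rho (l * q) : ℕ) * B := by
        refine mul_le_mul_of_nonneg_right ?_ hB0
        exact_mod_cast hcount

end Classes

/-! ### The families of pairs `(m, Θ)` and their Gauss reparametrisation -/

/-- The pairs `(m, Θ)` of Lemma 4 with the coprimality condition replaced by `l ∣ m`:
`A < m ≤ B`, `l ∣ m`, `m ≡ μ (mod d)`, `0 ≤ Θ < mq` a root of `Θ² + 1 ≡ 0 (mod mq)`,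
`Θ ≡ ω (mod d)`. [cite: IwaniecInventiones1978, Lemma 4] -/
def lemma4FamilyDvd (q l d μ ω A B : ℕ) : Finset (ℕ × ℕ) :=
  (Finset.Ioc A B ×ˢ Finset.range (B * q)).filter (fun p =>
    l ∣ p.1 ∧ p.1 ≡ μ [MOD d] ∧ p.2 < p.1 * q ∧ p.1 * q ∣ p.2 ^ 2 + 1 ∧ p.2 ≡ ω [MOD d])

/-- Membership in `lemma4FamilyDvd`. [folklore] -/
theorem mem_lemma4FamilyDvd {q l d μ ω A B : ℕ} {p : ℕ × ℕ} :
    p ∈ lemma4FamilyDvd q l d μ ω A B ↔ (A < p.1 ∧ p.1 ≤ B) ∧ l ∣ p.1 ∧ p.1 ≡ μ [MOD d] ∧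
      p.2 ∈ rootsNat (p.1 * q) ∧ p.2 ≡ ω [MOD d] := by
  simp only [lemma4FamilyDvd, Finset.mem_filter, Finset.mem_product, Finset.mem_Ioc,
    Finset.mem_range, mem_rootsNat]
  constructor
  · rintro ⟨⟨h1, -⟩, h2, h3, h4, h5, h6⟩
    exact ⟨h1, h2, h3, ⟨h4, h5⟩, h6⟩
  · rintro ⟨h1, h2, h3, ⟨h4, h5⟩, h6⟩
    refine ⟨⟨h1, ?_⟩, h2, h3, h4, h5, h6⟩
    calc p.2 < p.1 * q := h4
      _ ≤ B * q := Nat.mul_le_mul_right q h1.2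

/-- The family as an iterated sum over `m` and then `Θ`. [folklore] -/
theorem sum_lemma4FamilyDvd_eq {q l d μ ω A B : ℕ} (G : ℕ × ℕ → ℂ) :
    ∑ p ∈ lemma4FamilyDvd q l d μ ω A B, G p =
      ∑ m ∈ (Finset.Ioc A B).filter (fun m => l ∣ m ∧ m ≡ μ [MOD d]),
        ∑ Θ ∈ (rootsNat (m * q)).filter (fun Θ => Θ ≡ ω [MOD d]), G (m, Θ) := by
  classical
  have hfam : lemma4FamilyDvd q l d μ ω A B =
      ((Finset.Ioc A B).filter (fun m => l ∣ m ∧ m ≡ μ [MOD d])).biUnion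
        (fun m => ((rootsNat (m * q)).filter (fun Θ => Θ ≡ ω [MOD d])).image
          (fun Θ => (m, Θ))) := by
    ext p
    rw [mem_lemma4FamilyDvd, Finset.mem_biUnion]
    constructor
    · rintro ⟨h1, h2, h3, h4, h5⟩
      refine ⟨p.1, ?_, ?_⟩
      · rw [Finset.mem_filter, Finset.mem_Ioc]; exact ⟨h1, h2, h3⟩
      · rw [Finset.mem_image]; exact ⟨p.2, Finset.mem_filter.mpr ⟨h4, h5⟩, rfl⟩
    · rintro ⟨m, hm, hp⟩
      rw [Finset.mem_filter, Finset.mem_Ioc] at hm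
      rw [Finset.mem_image] at hp
      obtain ⟨Θ, hΘ, rfl⟩ := hp
      rw [Finset.mem_filter] at hΘ
      exact ⟨hm.1, hm.2.1, hm.2.2, hΘ.1, hΘ.2⟩
  rw [hfam, Finset.sum_biUnion]
  · refine Finset.sum_congr rfl fun m _ => ?_
    rw [Finset.sum_image]
    intro a _ b _ h
    exact (Prod.mk.inj h).2
  · intro m _ m' _ hne
    simp only [Function.onFun]
    rw [Finset.disjoint_left]
    intro p hp hp'
    rw [Finset.mem_image] at hp hp'
    obtain ⟨Θ, _, rfl⟩ := hp
    obtain ⟨Θ', _, h⟩ := hp'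
    exact hne (Prod.mk.inj h).1.symm

/-- **The root sum for one modulus in Gauss coordinates**: for `D ≠ 2`, `d ∣ D`,
`∑_{Θ root mod D, Θ ≡ ω (d)} e(hΘ/D) = ∑_{(r,s) ∈ gaussPairs D, r + ωs ≡ 0 (d)} e(h r̄/s) g(r)`.
[cite: IwaniecInventiones1978, §4 p. 180] -/
theorem sum_rootsNat_filter_fourierChar_eq {D d : ℕ} [NeZero D] [NeZero d] (hD2 : D ≠ 2)
    (hdD : d ∣ D) (ω : ℕ) (h : ℤ) :
    ∑ Θ ∈ (rootsNat D).filter (fun Θ => Θ ≡ ω [MOD d]), (𝐞 ((h : ℝ) * Θ / D) : ℂ) =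
      ∑ p ∈ (gaussPairs D).filter
        (fun p => (p.1 : ZMod d) + (ω : ZMod d) * (p.2 : ZMod d) = 0),
        hooleyPhase h p.2.toNat p.1 * twist h p.2.toNat p.1 := by
  classical
  set G : ZMod D → ℂ := fun x =>
    if x.val ≡ ω [MOD d] then (𝐞 ((h : ℝ) * (x.val : ℝ) / D) : ℂ) else 0 with hG
  have hL : ∑ Θ ∈ (rootsNat D).filter (fun Θ => Θ ≡ ω [MOD d]), (𝐞 ((h : ℝ) * Θ / D) : ℂ) =
      ∑ Θ ∈ rootsNat D, G (Θ : ZMod D) := by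
    rw [Finset.sum_filter]
    refine Finset.sum_congr rfl fun Θ hΘ => ?_
    rw [mem_rootsNat] at hΘ
    have hval : ((Θ : ZMod D)).val = Θ := ZMod.val_natCast_of_lt hΘ.1
    simp only [hG, hval]
  have hR : ∑ p ∈ (gaussPairs D).filter
        (fun p => (p.1 : ZMod d) + (ω : ZMod d) * (p.2 : ZMod d) = 0),
        hooleyPhase h p.2.toNat p.1 * twist h p.2.toNat p.1 =
      ∑ p ∈ gaussPairs D, G (gaussRoot D p) := by
    rw [Finset.sum_filter]
    refine Finset.sum_congr rfl fun p hp => ?_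
    simp only [hG]
    by_cases hc : (p.1 : ZMod d) + (ω : ZMod d) * (p.2 : ZMod d) = 0
    · rw [if_pos hc, if_pos ((gaussRoot_val_modEq_iff hdD hp ω).mpr hc),
        fourierChar_gaussRoot_eq hp h, twist]
      congr 2
      obtain ⟨hDeq, -, -⟩ := mem_gaussPairs.mp hp
      have hs : 0 < p.2 := snd_pos_of_mem hp
      have hsR : ((p.2.toNat : ℕ) : ℝ) = (p.2 : ℝ) := by
        have : ((p.2.toNat : ℕ) : ℤ) = p.2 := Int.toNat_of_nonneg hs.le
        exact_mod_cast this
      have hDR : ((p.1 : ℝ)) ^ 2 + ((p.2.toNat : ℕ) : ℝ) ^ 2 = (D : ℝ) := by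
        rw [hsR]; exact_mod_cast hDeq
      rw [hDR, hsR]
    · rw [if_neg hc, if_neg (fun h' => hc ((gaussRoot_val_modEq_iff hdD hp ω).mp h'))]
  rw [hL, hR, sum_rootsNat_eq_sum_gaussPairs hD2]

/-- The summand in Gauss coordinates, as a function of the pair `(r, s) ∈ ℤ²`. [folklore] -/
def gaussSummand (h : ℤ) (p : ℤ × ℤ) : ℂ := hooleyPhase h p.2.toNat p.1 * twist h p.2.toNat p.1

/-- The `r`-conditions for fixed `s` after the reparametrisation (coprimality, the three
congruences, the annulus `qA < r² + s² ≤ qB`). [cite: IwaniecInventiones1978, §4 p. 180] -/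
def gaussCond (q l d μ ω A B s : ℕ) (r : ℤ) : Prop :=
  Int.gcd r s = 1 ∧ ((l * q : ℕ) : ℤ) ∣ r ^ 2 + (s : ℤ) ^ 2 ∧
    r ^ 2 + (s : ℤ) ^ 2 ≡ ((q * μ : ℕ) : ℤ) [ZMOD ((q * d : ℕ) : ℤ)] ∧
    r + (ω : ℤ) * s ≡ 0 [ZMOD (d : ℤ)] ∧ ((A * q : ℕ) : ℤ) < r ^ 2 + (s : ℤ) ^ 2 ∧
    r ^ 2 + (s : ℤ) ^ 2 ≤ ((B * q : ℕ) : ℤ)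

/-- `gaussCond` is decidable (it is a finite conjunction of decidable conditions). [folklore] -/
instance (q l d μ ω A B s : ℕ) : DecidablePred (gaussCond q l d μ ω A B s) := by
  intro r; unfold gaussCond; infer_instance

/-- **The Gauss reparametrisation of the family sum**: for `q ≥ 1`, `d ∣ q`, `A ≥ 2`,
`∑_{(m,Θ)} e(hΘ/(mq)) = ∑_{1 ≤ s ≤ √(Bq)} ∑_{|r| < s, gaussCond} e(h r̄/s) g(r)`
(`D = mq = r² + s²`, Lemma 5; `mq ≥ 3` so `D ≠ 2`). [cite: IwaniecInventiones1978, §4 p. 180] -/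
theorem sum_lemma4FamilyDvd_fourierChar_eq {q l d μ ω A B : ℕ} (hq : 0 < q)
    (hdq : d ∣ q) (hA : 2 ≤ A) (h : ℤ) :
    ∑ p ∈ lemma4FamilyDvd q l d μ ω A B, (𝐞 ((h : ℝ) * p.2 / (p.1 * q)) : ℂ) =
      ∑ s ∈ Finset.Icc 1 (Nat.sqrt (B * q)),
        ∑ r ∈ (Finset.Ioo (-(s : ℤ)) s).filter (gaussCond q l d μ ω A B s),
          hooleyPhase h s r * twist h s r := by
  classical
  have hd : 0 < d := Nat.pos_of_dvd_of_pos hdq hq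
  haveI : NeZero d := ⟨hd.ne'⟩
  set Mset := (Finset.Ioc A B).filter (fun m => l ∣ m ∧ m ≡ μ [MOD d]) with hMset
  set GPf : ℕ → Finset (ℤ × ℤ) := fun D => (gaussPairs D).filter
    (fun p => (p.1 : ZMod d) + (ω : ZMod d) * (p.2 : ZMod d) = 0) with hGPf
  -- Steps 1–2: iterate over `m`, then pass to Gauss coordinates for each modulus
  have h12 : ∑ p ∈ lemma4FamilyDvd q l d μ ω A B, (𝐞 ((h : ℝ) * p.2 / (p.1 * q)) : ℂ) =
      ∑ m ∈ Mset, ∑ p ∈ GPf (m * q), gaussSummand h p := by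
    rw [sum_lemma4FamilyDvd_eq]
    refine Finset.sum_congr rfl fun m hm => ?_
    rw [hMset, Finset.mem_filter, Finset.mem_Ioc] at hm
    have hm3 : 3 ≤ m * q := by nlinarith [hm.1.1]
    haveI : NeZero (m * q) := ⟨by omega⟩
    have hdD : d ∣ m * q := hdq.trans (dvd_mul_left q m)
    have := sum_rootsNat_filter_fourierChar_eq (D := m * q) (by omega) hdD ω h
    simp only [gaussSummand]
    rw [← this]
    refine Finset.sum_congr rfl fun Θ _ => ?_
    push_cast
    ring_nf
  -- Step 3: the union over `m` is disjoint
  have h3 : ∑ m ∈ Mset, ∑ p ∈ GPf (m * q), gaussSummand h p =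
      ∑ p ∈ Mset.biUnion (fun m => GPf (m * q)), gaussSummand h p := by
    rw [Finset.sum_biUnion]
    intro m _ m' _ hne
    simp only [Function.onFun]
    rw [Finset.disjoint_left]
    intro p hp hp'
    simp only [hGPf, Finset.mem_filter] at hp hp'
    have e1 := (mem_gaussPairs.mp hp.1).1
    have e2 := (mem_gaussPairs.mp hp'.1).1
    rw [e1] at e2
    have : m * q = m' * q := by exact_mod_cast e2
    exact hne (Nat.eq_of_mul_eq_mul_right hq this)
  -- Step 4: the right-hand side as a sum over a union indexed by `s`
  set S := Nat.sqrt (B * q) with hS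
  have h4 : ∑ s ∈ Finset.Icc 1 S,
        ∑ r ∈ (Finset.Ioo (-(s : ℤ)) s).filter (gaussCond q l d μ ω A B s),
          hooleyPhase h s r * twist h s r =
      ∑ p ∈ (Finset.Icc 1 S).biUnion (fun s =>
        ((Finset.Ioo (-(s : ℤ)) s).filter (gaussCond q l d μ ω A B s)).image
          (fun r => (r, (s : ℤ)))), gaussSummand h p := by
    rw [Finset.sum_biUnion]
    · refine Finset.sum_congr rfl fun s _ => ?_
      rw [Finset.sum_image (fun a _ b _ hab => (Prod.mk.inj hab).1)]
      refine Finset.sum_congr rfl fun r _ => ?_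
      simp [gaussSummand]
    · intro s _ s' _ hne
      simp only [Function.onFun]
      rw [Finset.disjoint_left]
      intro p hp hp'
      rw [Finset.mem_image] at hp hp'
      obtain ⟨r, _, rfl⟩ := hp
      obtain ⟨r', _, h'⟩ := hp'
      have : (s' : ℤ) = s := (Prod.mk.inj h').2
      exact hne (by exact_mod_cast this.symm)
  rw [h12, h3, h4]
  -- Step 5: the two unions coincide
  congr 1
  ext p
  rw [Finset.mem_biUnion, Finset.mem_biUnion]
  constructor
  · -- from `(m, (r, s))` to `(s, r)`
    rintro ⟨m, hm, hp⟩
    rw [hMset, Finset.mem_filter, Finset.mem_Ioc] at hm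
    obtain ⟨⟨hAm, hmB⟩, hlm, hmμ⟩ := hm
    simp only [hGPf, Finset.mem_filter] at hp
    obtain ⟨hpg, hzmod⟩ := hp
    obtain ⟨hDeq, hgcd, hrs⟩ := mem_gaussPairs.mp hpg
    have hs0 : 0 < p.2 := snd_pos_of_mem hpg
    set sN := p.2.toNat with hsN
    have hsNeq : (sN : ℤ) = p.2 := Int.toNat_of_nonneg hs0.le
    refine ⟨sN, ?_, ?_⟩
    · rw [Finset.mem_Icc]
      refine ⟨by omega, ?_⟩
      rw [hS, Nat.le_sqrt]
      have h1 : (sN : ℤ) * sN ≤ ((B * q : ℕ) : ℤ) := by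
        rw [hsNeq]
        have : ((m * q : ℕ) : ℤ) ≤ ((B * q : ℕ) : ℤ) := by exact_mod_cast Nat.mul_le_mul_right q hmB
        nlinarith
      exact_mod_cast h1
    · rw [Finset.mem_image]
      refine ⟨p.1, ?_, ?_⟩
      · rw [Finset.mem_filter, Finset.mem_Ioo, hsNeq]
        refine ⟨abs_lt.mp hrs, ?_⟩
        refine ⟨?_, ?_, ?_, ?_, ?_, ?_⟩
        · rw [hsNeq]; exact hgcd
        · rw [hsNeq, hDeq]; exact_mod_cast mul_dvd_mul_right hlm q
        · rw [hsNeq, hDeq, show m * q = q * m from mul_comm _ _]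
          exact Int.natCast_modEq_iff.mpr (Nat.ModEq.mul_left' q hmμ)
        · rw [hsNeq, Int.modEq_zero_iff_dvd, ← ZMod.intCast_zmod_eq_zero_iff_dvd]
          push_cast; exact hzmod
        · rw [hsNeq, hDeq]; exact_mod_cast Nat.mul_lt_mul_of_pos_right hAm hq
        · rw [hsNeq, hDeq]; exact_mod_cast Nat.mul_le_mul_right q hmB
      · rw [hsNeq]
  · -- from `(s, r)` to `(m, (r, s))`
    rintro ⟨s, hs, hp⟩
    rw [Finset.mem_Icc] at hs
    rw [Finset.mem_image] at hp
    obtain ⟨r, hr, rfl⟩ := hp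
    rw [Finset.mem_filter, Finset.mem_Ioo] at hr
    obtain ⟨hrs, hgcd, hdvd, hmod, hzmod, hlo, hhi⟩ := hr
    -- the modulus `D = r² + s²` and `m = D/q`
    set Dn : ℕ := r.natAbs ^ 2 + s ^ 2 with hDn
    have hDnZ : (Dn : ℤ) = r ^ 2 + (s : ℤ) ^ 2 := by rw [hDn]; push_cast; rw [sq_abs]
    have hqDn : q ∣ Dn := by
      have : (q : ℤ) ∣ (Dn : ℤ) := by
        rw [hDnZ]; exact (Int.natCast_dvd_natCast.mpr (dvd_mul_left q l)).trans hdvd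
      exact_mod_cast this
    obtain ⟨m, hm⟩ := hqDn
    have hmq : m * q = Dn := by rw [hm, mul_comm]
    refine ⟨m, ?_, ?_⟩
    · rw [hMset, Finset.mem_filter, Finset.mem_Ioc]
      refine ⟨⟨?_, ?_⟩, ?_, ?_⟩
      · have : ((A * q : ℕ) : ℤ) < ((m * q : ℕ) : ℤ) := by rw [hmq, hDnZ]; exact hlo
        exact Nat.lt_of_mul_lt_mul_right (by exact_mod_cast this : A * q < m * q)
      · have : ((m * q : ℕ) : ℤ) ≤ ((B * q : ℕ) : ℤ) := by rw [hmq, hDnZ]; exact hhi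
        exact Nat.le_of_mul_le_mul_right (by exact_mod_cast this : m * q ≤ B * q) hq
      · have : l * q ∣ m * q := by
          have : ((l * q : ℕ) : ℤ) ∣ ((m * q : ℕ) : ℤ) := by rw [hmq, hDnZ]; exact hdvd
          exact_mod_cast this
        exact Nat.dvd_of_mul_dvd_mul_right hq this
      · have : q * m ≡ q * μ [MOD q * d] := by
          refine Int.natCast_modEq_iff.mp ?_
          have e : ((q * m : ℕ) : ℤ) = r ^ 2 + (s : ℤ) ^ 2 := by
            rw [mul_comm, hmq, hDnZ]
          rw [e]; exact hmod
        exact Nat.ModEq.mul_left_cancel' hq.ne' this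
    · simp only [hGPf, Finset.mem_filter]
      constructor
      · rw [hmq, mem_gaussPairs]
        exact ⟨hDnZ.symm, hgcd, abs_lt.mpr hrs⟩
      · have := (ZMod.intCast_zmod_eq_zero_iff_dvd (r + ω * s) d).mpr
          (Int.modEq_zero_iff_dvd.mp hzmod)
        push_cast at this ⊢
        exact this

/-! ### Summing the class bounds: over `s`, then over `l ∣ Q` -/

/-- `∑_{s ≤ S} √(h, s) ≤ τ(|h|) S` for `h ≠ 0`. [folklore] -/
theorem sum_sqrt_gcd_le {h : ℤ} (hh : h ≠ 0) (S : ℕ) :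
    ∑ s ∈ Finset.Icc 1 S, Real.sqrt (Int.gcd h s) ≤ (h.natAbs.divisors.card : ℝ) * S := by
  have hn0 : h.natAbs ≠ 0 := Int.natAbs_ne_zero.mpr hh
  -- `√(h,s) ≤ ∑_{g ∣ |h|, g ∣ s} √g`
  have h1 : ∀ s ∈ Finset.Icc 1 S, Real.sqrt (Int.gcd h s) ≤
      ∑ g ∈ h.natAbs.divisors, if g ∣ s then Real.sqrt g else 0 := by
    intro s _
    rw [← Finset.sum_filter]
    have hmem : Int.gcd h s ∈ h.natAbs.divisors.filter (fun g => g ∣ s) := by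
      rw [Finset.mem_filter, Nat.mem_divisors]
      refine ⟨⟨?_, hn0⟩, ?_⟩
      · exact Int.gcd_dvd_natAbs_left h s
      · have := Int.gcd_dvd_natAbs_right h s
        simpa using this
    exact Finset.single_le_sum (f := fun g : ℕ => Real.sqrt g) (fun _ _ => Real.sqrt_nonneg _) hmem
  refine (Finset.sum_le_sum h1).trans ?_
  rw [Finset.sum_comm]
  -- for each divisor `g`: `√g · #{s ≤ S : g ∣ s} ≤ S`
  have h2 : ∀ g ∈ h.natAbs.divisors,
      ∑ s ∈ Finset.Icc 1 S, (if g ∣ s then Real.sqrt g else 0) ≤ S := by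
    intro g hg
    have hg0 : 0 < g := Nat.pos_of_mem_divisors hg
    rw [← Finset.sum_filter, Finset.sum_const, nsmul_eq_mul]
    have hcard : ((Finset.Icc 1 S).filter (fun s => g ∣ s)).card ≤ S / g := by
      have hinj : Set.InjOn (fun s => s / g) ((Finset.Icc 1 S).filter (fun s => g ∣ s) : Set ℕ) := by
        intro a ha b hb hab
        rw [Finset.coe_filter, Set.mem_setOf_eq] at ha hb
        simp only at hab
        rw [← Nat.div_mul_cancel ha.2, ← Nat.div_mul_cancel hb.2, hab]
      have hmaps : Set.MapsTo (fun s => s / g) ((Finset.Icc 1 S).filter (fun s => g ∣ s) : Set ℕ)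
          (Finset.Icc 1 (S / g) : Set ℕ) := by
        intro s hs
        rw [Finset.coe_filter, Set.mem_setOf_eq, Finset.mem_Icc] at hs
        rw [Finset.coe_Icc, Set.mem_Icc]
        refine ⟨?_, Nat.div_le_div_right hs.1.2⟩
        rw [Nat.le_div_iff_mul_le hg0, one_mul]
        exact Nat.le_of_dvd hs.1.1 hs.2
      have := Finset.card_le_card_of_injOn _ hmaps hinj
      simpa using this
    have hsqrt : Real.sqrt g ≤ g := by
      have hg1 : (1 : ℝ) ≤ g := by exact_mod_cast hg0
      rw [Real.sqrt_le_left (by linarith)]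
      nlinarith
    calc (((Finset.Icc 1 S).filter (fun s => g ∣ s)).card : ℝ) * Real.sqrt g
        ≤ (S / g : ℕ) * (g : ℝ) := by
          refine mul_le_mul (by exact_mod_cast hcard) hsqrt (Real.sqrt_nonneg _) (Nat.cast_nonneg _)
      _ ≤ S := by
          have := Nat.div_mul_le_self S g
          exact_mod_cast this
  calc ∑ g ∈ h.natAbs.divisors, ∑ s ∈ Finset.Icc 1 S, (if g ∣ s then Real.sqrt g else 0)
      ≤ ∑ g ∈ h.natAbs.divisors, (S : ℝ) := Finset.sum_le_sum h2
    _ = (h.natAbs.divisors.card : ℝ) * S := by rw [Finset.sum_const, nsmul_eq_mul]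

section FixedL

variable {ε C : ℝ}

/-- **The exponential sum over one family `l ∣ m`**: Gauss coordinates, empty `s`-slices for
`2s² ≤ Aq`, the class bound for the others (`1/s² < 2/(Aq)`, `s ≤ S = ⌊√(Bq)⌋`), and the
`gcd`-sum. [cite: IwaniecInventiones1978, §4 pp. 180–181] -/
theorem norm_sum_lemma4FamilyDvd_le
    (hC : ∀ (s Λ : ℕ) (h r₁ r₂ lam : ℤ), 1 ≤ s → 1 ≤ Λ → r₁ < r₂ → r₂ - r₁ < 2 * s →
      ‖∑ r ∈ (Finset.Ioo r₁ r₂).filter (fun r : ℤ => Int.gcd r s = 1 ∧ r ≡ lam [ZMOD Λ]),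
          hooleyPhase h s r‖ ≤ C * (s : ℝ) ^ (1 / 2 + ε) * Real.sqrt (Int.gcd h s))
    (hε : 0 ≤ ε) {q l d μ ω A B : ℕ} (hq : 0 < q) (hl : 0 < l) (hdq : d ∣ q) (hA : 2 ≤ A)
    {h : ℤ} (hh : h ≠ 0) :
    ‖∑ p ∈ lemma4FamilyDvd q l d μ ω A B, (𝐞 ((h : ℝ) * p.2 / (p.1 * q)) : ℂ)‖ ≤
      (d * rho (l * q) : ℕ) * (2 * C * (3 + 8 * Real.pi * |(h : ℝ)| / (A * q)) *
        (h.natAbs.divisors.card : ℝ) * ((Nat.sqrt (B * q) : ℝ) ^ (1 / 2 + ε) * Nat.sqrt (B * q))) := by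
  have hd : 0 < d := Nat.pos_of_dvd_of_pos hdq hq
  set S := Nat.sqrt (B * q) with hS
  have hC0 : 0 ≤ C := by
    have := hC 1 1 h 0 1 0 le_rfl le_rfl zero_lt_one (by norm_num)
    have h' := (norm_nonneg _).trans this
    simpa using h'
  rw [sum_lemma4FamilyDvd_fourierChar_eq hq hdq hA]
  refine (norm_sum_le _ _).trans ?_
  -- the bound for each `s`
  set K : ℝ := (d * rho (l * q) : ℕ) * (2 * C * (3 + 8 * Real.pi * |(h : ℝ)| / (A * q)) *
    (S : ℝ) ^ (1 / 2 + ε)) with hK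
  have hK0 : 0 ≤ K := by rw [hK]; positivity
  have hper : ∀ s ∈ Finset.Icc 1 S,
      ‖∑ r ∈ (Finset.Ioo (-(s : ℤ)) s).filter (gaussCond q l d μ ω A B s),
          hooleyPhase h s r * twist h s r‖ ≤ K * Real.sqrt (Int.gcd h s) := by
    intro s hs
    rw [Finset.mem_Icc] at hs
    by_cases hsmall : 2 * s ^ 2 ≤ A * q
    · -- empty slice
      have hempty : (Finset.Ioo (-(s : ℤ)) s).filter (gaussCond q l d μ ω A B s) = ∅ := by
        rw [Finset.filter_eq_empty_iff]
        intro r hr hcond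
        rw [Finset.mem_Ioo] at hr
        obtain ⟨-, -, -, -, hlo, -⟩ := hcond
        have h1 : r ^ 2 ≤ ((s : ℤ) - 1) ^ 2 := by nlinarith
        have h2 : ((A * q : ℕ) : ℤ) ≥ 2 * (s : ℤ) ^ 2 := by exact_mod_cast hsmall
        nlinarith
      rw [hempty, Finset.sum_empty, norm_zero]
      positivity
    · rw [not_le] at hsmall
      have hs2 : 2 ≤ s := by
        by_contra hlt
        have hs1 : s = 1 := by omega
        subst hs1
        have : 2 ≤ A * q := by nlinarith
        omega
      have hmain := norm_sum_Ioo_congr_le hC hs2 hl hq hd h μ ω ((A * q : ℕ) : ℤ) ((B * q : ℕ) : ℤ)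
      have hrew : (Finset.Ioo (-(s : ℤ)) s).filter (gaussCond q l d μ ω A B s) =
          (Finset.Ioo (-(s : ℤ)) s).filter (fun r : ℤ => Int.gcd r s = 1 ∧
            ((l * q : ℕ) : ℤ) ∣ r ^ 2 + (s : ℤ) ^ 2 ∧
            r ^ 2 + (s : ℤ) ^ 2 ≡ ((q * μ : ℕ) : ℤ) [ZMOD ((q * d : ℕ) : ℤ)] ∧
            r + (ω : ℤ) * s ≡ 0 [ZMOD (d : ℤ)] ∧ ((A * q : ℕ) : ℤ) < r ^ 2 + (s : ℤ) ^ 2 ∧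
            r ^ 2 + (s : ℤ) ^ 2 ≤ ((B * q : ℕ) : ℤ)) := by
        refine Finset.filter_congr fun r _ => ?_
        rfl
      rw [hrew]
      refine hmain.trans ?_
      -- compare the two constants
      have hsS : (s : ℝ) ≤ S := by exact_mod_cast hs.2
      have hs0 : (0 : ℝ) < s := by exact_mod_cast (by omega : 0 < s)
      have hpow : (s : ℝ) ^ (1 / 2 + ε) ≤ (S : ℝ) ^ (1 / 2 + ε) :=
        Real.rpow_le_rpow hs0.le hsS (by linarith)
      have hinv : 4 * Real.pi * |(h : ℝ)| / (s : ℝ) ^ 2 ≤ 8 * Real.pi * |(h : ℝ)| / (A * q) := by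
        have hAq : (0 : ℝ) < A * q := by
          have : (0 : ℝ) < A := by exact_mod_cast (by omega : 0 < A)
          have : (0 : ℝ) < q := by exact_mod_cast hq
          positivity
        have hlt : (A : ℝ) * q < 2 * (s : ℝ) ^ 2 := by exact_mod_cast hsmall
        rw [div_le_div_iff₀ (by positivity) hAq]
        have h0 : 0 ≤ Real.pi * |(h : ℝ)| := by positivity
        nlinarith
      have hsq0 : 0 ≤ Real.sqrt (Int.gcd h s) := Real.sqrt_nonneg _
      have hρ0 : (0 : ℝ) ≤ (d * rho (l * q) : ℕ) := Nat.cast_nonneg _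
      rw [hK]
      have e1 : C * (s : ℝ) ^ (1 / 2 + ε) * Real.sqrt (Int.gcd h s) *
          (3 + 4 * Real.pi * |(h : ℝ)| / (s : ℝ) ^ 2) ≤
          C * (S : ℝ) ^ (1 / 2 + ε) * Real.sqrt (Int.gcd h s) *
          (3 + 8 * Real.pi * |(h : ℝ)| / (A * q)) := by
        have h3 : 0 ≤ 3 + 4 * Real.pi * |(h : ℝ)| / (s : ℝ) ^ 2 := by positivity
        refine mul_le_mul ?_ (by linarith) h3 (by positivity)
        exact mul_le_mul_of_nonneg_right (mul_le_mul_of_nonneg_left hpow hC0) hsq0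
      calc ((d * rho (l * q) : ℕ) : ℝ) * (2 * (C * (s : ℝ) ^ (1 / 2 + ε) * Real.sqrt (Int.gcd h s) *
            (3 + 4 * Real.pi * |(h : ℝ)| / (s : ℝ) ^ 2)))
          ≤ ((d * rho (l * q) : ℕ) : ℝ) * (2 * (C * (S : ℝ) ^ (1 / 2 + ε) * Real.sqrt (Int.gcd h s) *
            (3 + 8 * Real.pi * |(h : ℝ)| / (A * q)))) := by
            refine mul_le_mul_of_nonneg_left ?_ hρ0
            linarith
        _ = _ := by ring
  calc ∑ s ∈ Finset.Icc 1 S, ‖∑ r ∈ (Finset.Ioo (-(s : ℤ)) s).filter (gaussCond q l d μ ω A B s),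
          hooleyPhase h s r * twist h s r‖
      ≤ ∑ s ∈ Finset.Icc 1 S, K * Real.sqrt (Int.gcd h s) := Finset.sum_le_sum hper
    _ = K * ∑ s ∈ Finset.Icc 1 S, Real.sqrt (Int.gcd h s) := by rw [Finset.mul_sum]
    _ ≤ K * ((h.natAbs.divisors.card : ℝ) * S) :=
        mul_le_mul_of_nonneg_left (sum_sqrt_gcd_le hh S) hK0
    _ = _ := by rw [hK]; ring

end FixedL

/-! ### Möbius inversion of the coprimality condition and the final bound -/

/-- The family of Lemma 4: pairs `(m, Θ)` with `A < m ≤ B`, `(m, Q) = 1`, `m ≡ μ (mod d)`,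
`0 ≤ Θ < mq` a root of `Θ² + 1 ≡ 0 (mod mq)`, `Θ ≡ ω (mod d)`.
[cite: IwaniecInventiones1978, Lemma 4] -/
def lemma4Family (q Q d μ ω A B : ℕ) : Finset (ℕ × ℕ) :=
  (lemma4FamilyDvd q 1 d μ ω A B).filter (fun p => p.1.Coprime Q)

/-- Membership in `lemma4Family`. [folklore] -/
theorem mem_lemma4Family {q Q d μ ω A B : ℕ} {p : ℕ × ℕ} :
    p ∈ lemma4Family q Q d μ ω A B ↔ (A < p.1 ∧ p.1 ≤ B) ∧ p.1.Coprime Q ∧ p.1 ≡ μ [MOD d] ∧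
      p.2 ∈ rootsNat (p.1 * q) ∧ p.2 ≡ ω [MOD d] := by
  rw [lemma4Family, Finset.mem_filter, mem_lemma4FamilyDvd]
  simp only [one_dvd, true_and]
  tauto

/-- **Möbius detection of `(m, Q) = 1`** (over `ℂ`): `[(m,Q)=1] = ∑_{l ∣ Q} μ(l) [l ∣ m]` for
`m ≠ 0`. [folklore] -/
theorem ite_coprime_eq_sum_moebius_ite {m Q : ℕ} (hm : m ≠ 0) (hQ : Q ≠ 0) :
    (if m.Coprime Q then (1 : ℂ) else 0) =
      ∑ l ∈ Q.divisors, (ArithmeticFunction.moebius l : ℂ) * (if l ∣ m then 1 else 0) := by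
  have hset : ∀ l ∈ Q.divisors, (ArithmeticFunction.moebius l : ℂ) * (if l ∣ m then 1 else 0) =
      if l ∣ m then (ArithmeticFunction.moebius l : ℂ) else 0 := by
    intro l _; split_ifs <;> simp
  rw [Finset.sum_congr rfl hset, ← Finset.sum_filter]
  have hfil : Q.divisors.filter (fun l => l ∣ m) = (m.gcd Q).divisors := by
    ext l
    simp only [Finset.mem_filter, Nat.mem_divisors, Nat.dvd_gcd_iff]
    constructor
    · rintro ⟨⟨hlQ, -⟩, hlm⟩; exact ⟨⟨hlm, hlQ⟩, Nat.gcd_ne_zero_left hm⟩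
    · rintro ⟨⟨hlm, hlQ⟩, -⟩; exact ⟨⟨hlQ, hQ⟩, hlm⟩
  rw [hfil]
  have hz : ∑ i ∈ (m.gcd Q).divisors, (ArithmeticFunction.moebius i : ℤ) =
      if m.gcd Q = 1 then 1 else 0 := by
    rw [← ArithmeticFunction.coe_mul_zeta_apply, ArithmeticFunction.moebius_mul_coe_zeta,
      ArithmeticFunction.one_apply]
  have := congrArg (fun z : ℤ => (z : ℂ)) hz
  push_cast at this
  rw [this]

/-- `∑_{family} G = ∑_{l ∣ Q} μ(l) ∑_{family with l ∣ m} G`. [folklore] -/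
theorem sum_lemma4Family_eq_sum_moebius {q Q d μ ω A B : ℕ} (hQ : Q ≠ 0) (G : ℕ × ℕ → ℂ) :
    ∑ p ∈ lemma4Family q Q d μ ω A B, G p =
      ∑ l ∈ Q.divisors, (ArithmeticFunction.moebius l : ℂ) *
        ∑ p ∈ lemma4FamilyDvd q l d μ ω A B, G p := by
  classical
  rw [lemma4Family, Finset.sum_filter]
  have h1 : ∀ p ∈ lemma4FamilyDvd q 1 d μ ω A B, (if p.1.Coprime Q then G p else 0) =
      ∑ l ∈ Q.divisors, (ArithmeticFunction.moebius l : ℂ) * (if l ∣ p.1 then G p else 0) := by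
    intro p hp
    rw [mem_lemma4FamilyDvd] at hp
    have hm : p.1 ≠ 0 := by have := hp.1.1; omega
    have := ite_coprime_eq_sum_moebius_ite hm hQ
    calc (if p.1.Coprime Q then G p else 0) = (if p.1.Coprime Q then (1 : ℂ) else 0) * G p := by
          split_ifs <;> simp
      _ = ∑ l ∈ Q.divisors, (ArithmeticFunction.moebius l : ℂ) * (if l ∣ p.1 then 1 else 0) * G p := by
          rw [this, Finset.sum_mul]
      _ = _ := Finset.sum_congr rfl fun l _ => by split_ifs <;> simp
  rw [Finset.sum_congr rfl h1, Finset.sum_comm]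
  refine Finset.sum_congr rfl fun l _ => ?_
  rw [← Finset.mul_sum, ← Finset.sum_filter]
  congr 1
  apply Finset.sum_congr _ (fun _ _ => rfl)
  ext p
  rw [Finset.mem_filter, mem_lemma4FamilyDvd, mem_lemma4FamilyDvd]
  simp only [one_dvd, true_and]
  tauto

/-- **The exponential sums of Lemma 4, from Lemma 6.**  Assuming Hooley's bound
`lemma6_hooley`, for every `ε > 0` there is `C ≥ 0` such that for `Q ≠ 0`, `q ≥ 1`, `d ∣ q`,
`A ≥ 2`, any `B, μ, ω` and every integer `h ≠ 0`,
`|∑_{(m,Θ) ∈ family} e(hΘ/(mq))| ≤ C d (∑_{l∣Q} ρ(lq)) τ(|h|) (3 + 8π|h|/(Aq)) S^{1/2+ε} S`,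
`S = ⌊√(Bq)⌋` (so `≪ d τ(Q)³ τ(h)(1 + |h|/(qA)) (qB)^{3/4+ε}`): Iwaniec's estimate of the sum in
(11), p. 180, with the factor `d` kept (affordable on average downstream).
[cite: IwaniecInventiones1978, §4 pp. 180–181] -/
theorem norm_rootExpSum_le (h6 : lemma6_hooley) {ε : ℝ} (hε : 0 < ε) :
    ∃ C : ℝ, 0 ≤ C ∧ ∀ (q Q d μ ω A B : ℕ) (h : ℤ), Q ≠ 0 → 0 < q → d ∣ q → 2 ≤ A → h ≠ 0 →
      ‖∑ p ∈ lemma4Family q Q d μ ω A B, (𝐞 ((h : ℝ) * p.2 / (p.1 * q)) : ℂ)‖ ≤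
        C * d * (∑ l ∈ Q.divisors, (rho (l * q) : ℝ)) * (h.natAbs.divisors.card : ℝ) *
          (3 + 8 * Real.pi * |(h : ℝ)| / (A * q)) *
          ((Nat.sqrt (B * q) : ℝ) ^ (1 / 2 + ε) * Nat.sqrt (B * q)) := by
  obtain ⟨C, hC⟩ := h6 ε hε
  have hC' : ∀ (s Λ : ℕ) (h r₁ r₂ lam : ℤ), 1 ≤ s → 1 ≤ Λ → r₁ < r₂ → r₂ - r₁ < 2 * s →
      ‖∑ r ∈ (Finset.Ioo r₁ r₂).filter (fun r : ℤ => Int.gcd r s = 1 ∧ r ≡ lam [ZMOD Λ]),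
          hooleyPhase h s r‖ ≤ C * (s : ℝ) ^ (1 / 2 + ε) * Real.sqrt (Int.gcd h s) := by
    intro s Λ h r₁ r₂ lam hs hΛ h12 hlen
    exact hC s Λ h r₁ r₂ lam hs hΛ h12 hlen
  have hC0 : 0 ≤ C := by
    have := hC' 1 1 0 0 1 0 le_rfl le_rfl zero_lt_one (by norm_num)
    have h' := (norm_nonneg _).trans this
    simpa using h'
  refine ⟨2 * C, by positivity, ?_⟩
  intro q Q d μ ω A B h hQ hq hdq hA hh
  have hd : 0 < d := Nat.pos_of_dvd_of_pos hdq hq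
  rw [sum_lemma4Family_eq_sum_moebius hQ]
  refine (norm_sum_le _ _).trans ?_
  have hper : ∀ l ∈ Q.divisors, ‖(ArithmeticFunction.moebius l : ℂ) *
      ∑ p ∈ lemma4FamilyDvd q l d μ ω A B, (𝐞 ((h : ℝ) * p.2 / (p.1 * q)) : ℂ)‖ ≤
      (d * rho (l * q) : ℕ) * (2 * C * (3 + 8 * Real.pi * |(h : ℝ)| / (A * q)) *
        (h.natAbs.divisors.card : ℝ) *
        ((Nat.sqrt (B * q) : ℝ) ^ (1 / 2 + ε) * Nat.sqrt (B * q))) := by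
    intro l hl
    have hl0 : 0 < l := Nat.pos_of_mem_divisors hl
    rw [norm_mul]
    have hμ : ‖(ArithmeticFunction.moebius l : ℂ)‖ ≤ 1 := by
      rw [Complex.norm_intCast]
      exact_mod_cast ArithmeticFunction.abs_moebius_le_one
    have hmain := norm_sum_lemma4FamilyDvd_le hC' hε.le hq hl0 hdq hA hh (μ := μ) (ω := ω) (B := B)
    calc _ ≤ 1 * _ := mul_le_mul hμ hmain (norm_nonneg _) zero_le_one
      _ = _ := one_mul _
  refine (Finset.sum_le_sum hper).trans ?_
  simp only [Finset.mul_sum, Finset.sum_mul]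
  refine Finset.sum_le_sum fun l _ => le_of_eq ?_
  push_cast
  ring

end Literature.NumberTheory.Sieve.Iwaniec1978

end
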